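import Mathlib.Analysis.FunctionalSpaces.SobolevInequality
import Mathlib.Analysis.ODE.Gronwall
import Mathlib.Analysis.Calculus.ParametricIntegral
import Literature.MathematicalPhysics.QuantumLattice.YangMillsHeatFlowBochner
import Literature.MathematicalPhysics.QuantumLattice.YangMillsHeatFlowLocalEnergy
import HarnessLib

/-!
# Persistence of small energy on a ball: Waldron 2019, Proposition 3.4 (flat case)

A step of the printed proof of Waldron's Theorem 1.1 (A. Waldron, *Long-time existence for
Yang–Mills flow*, Invent. math. 217 (2019), §3, Prop. 3.4), on which the named fact
`Literature.MathematicalPhysics.QuantumLattice.Waldron2019_yangMillsFlow_flatTorus` rests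
(`Waldron2019_yangMillsFlow_flatTorus_of_thm11`). Flat setting of the named fact (`E` a
four-dimensional real inner product space, `B ∝ ‖Rm‖ = 0`, `R₀ = ∞`): if initially
`‖F(t₀)‖²_{L²(B_R)} ≤ ε₁ < ε₀` and the energy of the annulus `U_{R/2}^R` stays below `ε₂ < ε₀`, then
`‖F(t)‖²_{L²(B_{R/2})} ≤ ε₁ e^{−c(t−t₀)/R²} + C ε₂ (1 − e^{−c(t−t₀)/R²})`. Proof as printed, for the
density `e = |F|²` instead of `v = |F|`: the differential inequality
`(∂ₜ − Δ)e ≤ −∑‖DᵢF_{jk}‖² + A e^{3/2}` (`YangMillsHeatFlowBochner`) tested against `φ²` for a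
cut-off `φ` of `B_{R/2} ⊂ B_R`, the Sobolev inequality `W^{1,2} ⊂ L⁴` on `ℝ⁴` (Mathlib's
Gagliardo–Nirenberg–Sobolev inequality) applied to `φ√(e + δ²)`, Hölder, Grönwall, and a
continuity argument for the first time the energy of `B_R` reaches `η`.

* dominated-convergence tools on a slab `𝒯 × E`: `exists_bound_of_continuousOn_slab`,
  `continuousOn_integral_mul_of_continuousOn_slab`, `continuousOn_setIntegral_of_continuousOn_slab`
  (continuity of `t ↦ ∫ ψ g(t,·)`, `t ↦ ∫_V g(t,·)`), `hasDerivAt_integral_mul_of_hasDerivAt_slab`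
  (differentiation under the integral);
* `sobolev_sqrt_le_of_finrank_eq_four` — `√(∫ w⁴) ≤ C_S ∫ ‖Dw‖²` for `w ∈ C¹_c` (`dim E = 4`);
  `setIntegral_sq_le_sqrt_measure_mul_sqrt` — `∫_V w² ≤ √|V| √(∫ w⁴)`;
  `integral_mul_sqrt_le_sqrt_mul_sqrt` — `∫ f √g ≤ √(∫f²) √(∫_V g)`;
* `norm_fderiv_ymDensityOfBasis_sq_le` — the Kato-type bound `‖De‖² ≤ 2e ∑‖DᵢF_{jk}‖²`;
  `norm_fderiv_mul_sqrt_sq_le` — `‖D(φ√(e+δ²))‖² ≤ 2(e+δ²)‖Dφ‖² + φ²∑‖DᵢF_{jk}‖²`;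
  `integral_sq_mul_laplacian_ymDensity_le` — `∫ φ² Δe ≤ ½∫φ²∑‖DᵢF_{jk}‖² + 4∫e‖Dφ‖²`;
* `integral_sq_mul_le_of_subsolution` — the fixed-time core:
  `∫ φ² ė ≤ −(κ/√|V|) ∫ φ² e + 5K² ∫_U e` whenever `ė ≤ Δe − ∑‖DᵢF_{jk}‖² + A₃e^{3/2}` and
  `κ = 1/(2C_S) − A₃√(∫_V e) ≥ 0`;
* `hasDerivAt_localizedEnergy_le_of_flow_on` — the same along the flow (`ė = ∂ₜe`, Bochner);
* `le_exp_decay_of_deriv_le` (Grönwall), `volume_ball_toReal_of_finrank_eq_four`;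
* `Waldron2019_prop_3_4` — **the proposition**.

References: A. Waldron, *Long-time existence for Yang–Mills flow*, Invent. math. 217 (2019),
1069–1147, Prop. 3.4 [Waldron2019].
-/

noncomputable section

open scoped ContDiff Topology RealInnerProductSpace Matrix NNReal ENNReal
open Set Filter MeasureTheory Metric

namespace Literature.MathematicalPhysics.QuantumLattice

/-! ### Parametric integrals of slab-continuous integrands -/

section SlabIntegrals

variable {E : Type*} [NormedAddCommGroup E] [InnerProductSpace ℝ E] [FiniteDimensional ℝ E]
  [MeasurableSpace E] [BorelSpace E]

omit [InnerProductSpace ℝ E] [FiniteDimensional ℝ E] [MeasurableSpace E] [BorelSpace E] in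
/-- A continuous function on `𝒯 × E` is bounded on `[a, c] × K` for `K` compact, `[a, c] ⊆ 𝒯`.
[folklore] -/
theorem exists_bound_of_continuousOn_slab {𝒯 : Set ℝ} {g : ℝ × E → ℝ} {K : Set E}
    (hK : IsCompact K) (hg : ContinuousOn g (𝒯 ×ˢ (univ : Set E))) {a c : ℝ}
    (hsub : Icc a c ⊆ 𝒯) : ∃ M : ℝ, 0 ≤ M ∧ ∀ s ∈ Icc a c, ∀ y ∈ K, |g (s, y)| ≤ M := by
  have hc : ContinuousOn g (Icc a c ×ˢ K) := hg.mono (prod_mono hsub (subset_univ K))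
  obtain ⟨M, hM⟩ := (isCompact_Icc.prod hK).exists_bound_of_continuousOn hc
  refine ⟨max M 0, le_max_right _ _, fun s hs y hy => ?_⟩
  exact ((Real.norm_eq_abs _).symm.le.trans (hM (s, y) ⟨hs, hy⟩)).trans (le_max_left _ _)

/-- **Continuity of `t ↦ ∫ ψ(y) g(t, y) dy`** for `g` continuous on the slab `𝒯 × E` (`𝒯` open)
and `ψ` continuous with compact support (dominated convergence). [folklore] -/
theorem continuousOn_integral_mul_of_continuousOn_slab {𝒯 : Set ℝ} (h𝒯 : IsOpen 𝒯)
    {g : ℝ × E → ℝ} (hg : ContinuousOn g (𝒯 ×ˢ (univ : Set E)))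
    {ψ : E → ℝ} (hψ : Continuous ψ) (hψc : HasCompactSupport ψ) :
    ContinuousOn (fun s => ∫ y, ψ y * g (s, y)) 𝒯 := by
  intro s₀ hs₀
  refine ContinuousAt.continuousWithinAt ?_
  -- a compact time interval around `s₀` inside `𝒯`
  obtain ⟨ε, hε, hball⟩ := Metric.mem_nhds_iff.mp (h𝒯.mem_nhds hs₀)
  have hIcc : Icc (s₀ - ε / 2) (s₀ + ε / 2) ⊆ 𝒯 := fun s hs =>
    hball (mem_ball.mpr (by rw [Real.dist_eq]; exact abs_lt.mpr ⟨by linarith [hs.1], by linarith [hs.2]⟩))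
  have hIcc_nhds : Icc (s₀ - ε / 2) (s₀ + ε / 2) ∈ 𝓝 s₀ := Icc_mem_nhds (by linarith) (by linarith)
  set K : Set E := tsupport ψ with hK
  have hKc : IsCompact K := hψc
  obtain ⟨M, hM0, hM⟩ := exists_bound_of_continuousOn_slab hKc hg hIcc
  obtain ⟨P, hP⟩ := hψ.bounded_above_of_compact_support hψc
  have hP0 : 0 ≤ P := (norm_nonneg _).trans (hP 0)
  have hslice : ∀ {s : ℝ}, s ∈ 𝒯 → Continuous fun y => g (s, y) := fun hs =>
    continuous_slice_of_continuousOn_slab hg hs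
  refine continuousAt_of_dominated (bound := K.indicator fun _ => P * M) ?_ ?_ ?_ ?_
  · filter_upwards [h𝒯.mem_nhds hs₀] with s hs
    exact (hψ.mul (hslice hs)).aestronglyMeasurable
  · filter_upwards [hIcc_nhds] with s hs
    refine ae_of_all _ fun y => ?_
    by_cases hy : y ∈ K
    · rw [indicator_of_mem hy, norm_mul, Real.norm_eq_abs (g (s, y))]
      exact mul_le_mul (hP y) (hM s hs y hy) (abs_nonneg _) hP0
    · rw [indicator_of_notMem hy, image_eq_zero_of_notMem_tsupport hy, zero_mul, norm_zero]
  · rw [integrable_indicator_iff hKc.isClosed.measurableSet]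
    exact integrableOn_const hKc.measure_lt_top.ne
  · refine ae_of_all _ fun y => ?_
    have hgc : ContinuousAt (fun s => g (s, y)) s₀ :=
      (hg.continuousAt ((h𝒯.prod isOpen_univ).mem_nhds ⟨hs₀, mem_univ y⟩)).comp
        (continuous_id.prodMk continuous_const).continuousAt
    exact continuousAt_const.mul hgc

/-- **Continuity of `t ↦ ∫_V g(t, y) dy`** for `g` continuous on the slab `𝒯 × E` (`𝒯` open) and
`V` contained in a compact set (dominated convergence). [folklore] -/
theorem continuousOn_setIntegral_of_continuousOn_slab {𝒯 : Set ℝ} (h𝒯 : IsOpen 𝒯)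
    {g : ℝ × E → ℝ} (hg : ContinuousOn g (𝒯 ×ˢ (univ : Set E))) {K V : Set E}
    (hK : IsCompact K) (hVK : V ⊆ K) (hV : MeasurableSet V) :
    ContinuousOn (fun s => ∫ y in V, g (s, y)) 𝒯 := by
  intro s₀ hs₀
  refine ContinuousAt.continuousWithinAt ?_
  obtain ⟨ε, hε, hball⟩ := Metric.mem_nhds_iff.mp (h𝒯.mem_nhds hs₀)
  have hIcc : Icc (s₀ - ε / 2) (s₀ + ε / 2) ⊆ 𝒯 := fun s hs =>
    hball (mem_ball.mpr (by rw [Real.dist_eq]; exact abs_lt.mpr ⟨by linarith [hs.1], by linarith [hs.2]⟩))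
  have hIcc_nhds : Icc (s₀ - ε / 2) (s₀ + ε / 2) ∈ 𝓝 s₀ := Icc_mem_nhds (by linarith) (by linarith)
  obtain ⟨M, hM0, hM⟩ := exists_bound_of_continuousOn_slab hK hg hIcc
  have hslice : ∀ {s : ℝ}, s ∈ 𝒯 → Continuous fun y => g (s, y) := fun hs =>
    continuous_slice_of_continuousOn_slab hg hs
  have hVfin : volume V < ⊤ := (measure_mono hVK).trans_lt hK.measure_lt_top
  refine continuousAt_of_dominated (μ := volume.restrict V) (bound := fun _ => M) ?_ ?_ ?_ ?_
  · filter_upwards [h𝒯.mem_nhds hs₀] with s hs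
    exact (hslice hs).aestronglyMeasurable
  · filter_upwards [hIcc_nhds] with s hs
    refine (ae_restrict_iff' hV).mpr (ae_of_all _ fun y hy => ?_)
    rw [Real.norm_eq_abs]
    exact hM s hs y (hVK hy)
  · exact integrableOn_const hVfin.ne
  · refine ae_of_all _ fun y => ?_
    exact (hg.continuousAt ((h𝒯.prod isOpen_univ).mem_nhds ⟨hs₀, mem_univ y⟩)).comp
      (continuous_id.prodMk continuous_const).continuousAt

/-- **Differentiation under the integral sign** on a slab: if `e, ė` are continuous on `𝒯 × E`
(`𝒯` open) with `∂ₜ e(t, y) = ė(t, y)` for `t ∈ 𝒯`, and `ψ` is continuous with compact support,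
then `d/dt ∫ ψ e(t,·) = ∫ ψ ė(t,·)` at every `t₀ ∈ 𝒯`. [folklore] -/
theorem hasDerivAt_integral_mul_of_hasDerivAt_slab {𝒯 : Set ℝ} (h𝒯 : IsOpen 𝒯)
    {e rate : ℝ × E → ℝ} (he : ContinuousOn e (𝒯 ×ˢ (univ : Set E)))
    (hrate : ContinuousOn rate (𝒯 ×ˢ (univ : Set E)))
    (hderiv : ∀ s ∈ 𝒯, ∀ y, HasDerivAt (fun s' => e (s', y)) (rate (s, y)) s)
    {ψ : E → ℝ} (hψ : Continuous ψ) (hψc : HasCompactSupport ψ) {s₀ : ℝ} (hs₀ : s₀ ∈ 𝒯) :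
    HasDerivAt (fun s => ∫ y, ψ y * e (s, y)) (∫ y, ψ y * rate (s₀, y)) s₀ := by
  obtain ⟨ε, hε, hball⟩ := Metric.mem_nhds_iff.mp (h𝒯.mem_nhds hs₀)
  have hIcc : Icc (s₀ - ε / 2) (s₀ + ε / 2) ⊆ 𝒯 := fun s hs =>
    hball (mem_ball.mpr (by rw [Real.dist_eq]; exact abs_lt.mpr ⟨by linarith [hs.1], by linarith [hs.2]⟩))
  have hballI : ball s₀ (ε / 2) ⊆ Icc (s₀ - ε / 2) (s₀ + ε / 2) := fun s hs => by
    have h := abs_lt.mp (by rwa [mem_ball, Real.dist_eq] at hs)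
    exact ⟨by linarith [h.1], by linarith [h.2]⟩
  set K : Set E := tsupport ψ with hK
  have hKc : IsCompact K := hψc
  obtain ⟨M, hM0, hM⟩ := exists_bound_of_continuousOn_slab hKc hrate hIcc
  obtain ⟨P, hP⟩ := hψ.bounded_above_of_compact_support hψc
  have hP0 : 0 ≤ P := (norm_nonneg _).trans (hP 0)
  have hslice : ∀ {f : ℝ × E → ℝ}, ContinuousOn f (𝒯 ×ˢ (univ : Set E)) → ∀ {s : ℝ}, s ∈ 𝒯 →
      Continuous fun y => f (s, y) := fun hf s hs => continuous_slice_of_continuousOn_slab hf hs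
  have h := hasDerivAt_integral_of_dominated_loc_of_deriv_le (μ := volume)
    (F := fun s y => ψ y * e (s, y)) (F' := fun s y => ψ y * rate (s, y)) (x₀ := s₀)
    (bound := K.indicator fun _ => P * M) (ball_mem_nhds s₀ (by positivity : (0 : ℝ) < ε / 2))
    ?_ ?_ ?_ ?_ ?_ ?_
  · exact h.2
  · filter_upwards [h𝒯.mem_nhds hs₀] with s hs
    exact (hψ.mul (hslice he hs)).aestronglyMeasurable
  · exact (hψ.mul (hslice he hs₀)).integrable_of_hasCompactSupport hψc.mul_right
  · exact (hψ.mul (hslice hrate hs₀)).aestronglyMeasurable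
  · refine ae_of_all _ fun y s hs => ?_
    by_cases hy : y ∈ K
    · rw [indicator_of_mem hy, norm_mul, Real.norm_eq_abs (rate (s, y))]
      exact mul_le_mul (hP y) (hM s (hballI hs) y hy) (abs_nonneg _) hP0
    · rw [indicator_of_notMem hy, image_eq_zero_of_notMem_tsupport hy, zero_mul, norm_zero]
  · rw [integrable_indicator_iff hKc.isClosed.measurableSet]
    exact integrableOn_const hKc.measure_lt_top.ne
  · refine ae_of_all _ fun y s hs => ?_
    exact (hderiv s (hIcc (hballI hs)) y).const_mul (ψ y)

end SlabIntegrals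

/-! ### Sobolev and Hölder on a four-dimensional space -/

section Sobolev

variable {E : Type*} [NormedAddCommGroup E] [InnerProductSpace ℝ E] [FiniteDimensional ℝ E]
  [MeasurableSpace E] [BorelSpace E]

/-- **The Sobolev inequality `W^{1,2} ⊂ L⁴` in dimension four**, in real-integral form: there is
`C_S > 0` with `√(∫ w⁴) ≤ C_S ∫ ‖Dw‖²` for every `C¹` compactly supported `w : E → ℝ`
(Mathlib's Gagliardo–Nirenberg–Sobolev inequality `eLpNorm_le_eLpNorm_fderiv_of_eq_inner` with
`p = 2`, `p' = 4`, `n = 4`). [folklore] -/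
theorem sobolev_sqrt_le_of_finrank_eq_four (hE : Module.finrank ℝ E = 4) :
    ∃ Cs : ℝ, 0 < Cs ∧ ∀ w : E → ℝ, ContDiff ℝ 1 w → HasCompactSupport w →
      Real.sqrt (∫ y, w y ^ 4) ≤ Cs * ∫ y, ‖fderiv ℝ w y‖ ^ 2 := by
  set C : ℝ≥0 := eLpNormLESNormFDerivOfEqInnerConst (volume : Measure E) ((2 : ℝ≥0) : ℝ) with hC
  refine ⟨(C : ℝ) ^ 2 + 1, by positivity, fun w hw hwc => ?_⟩
  have hn : 0 < Module.finrank ℝ E := by rw [hE]; norm_num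
  have hp' : ((4 : ℝ≥0) : ℝ)⁻¹ = ((2 : ℝ≥0) : ℝ)⁻¹ - (Module.finrank ℝ E : ℝ)⁻¹ := by
    rw [hE]; norm_num
  have h := eLpNorm_le_eLpNorm_fderiv_of_eq_inner (μ := (volume : Measure E)) hw hwc
    (p := 2) (p' := 4) (by norm_num) hn hp'
  simp only [ENNReal.coe_ofNat] at h
  -- the two `eLpNorm`s as real integrals
  have hw4 : MemLp w 4 (volume : Measure E) := hw.continuous.memLp_of_hasCompactSupport hwc
  have hdw : MemLp (fderiv ℝ w) 2 (volume : Measure E) :=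
    (hw.continuous_fderiv one_ne_zero).memLp_of_hasCompactSupport (hwc.fderiv (𝕜 := ℝ))
  set a : ℝ := ∫ y, w y ^ 4 with ha
  set d : ℝ := ∫ y, ‖fderiv ℝ w y‖ ^ 2 with hd
  have ha0 : 0 ≤ a := integral_nonneg fun y => by show (0 : ℝ) ≤ w y ^ 4; positivity
  have hd0 : 0 ≤ d := integral_nonneg fun y => by show (0 : ℝ) ≤ ‖fderiv ℝ w y‖ ^ 2; positivity
  have ha' : ∫ y, ‖w y‖ ^ (4 : ℝ) = a := by
    refine integral_congr_ae (ae_of_all _ fun y => ?_)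
    show ‖w y‖ ^ (4 : ℝ) = w y ^ 4
    rw [Real.rpow_ofNat, Real.norm_eq_abs, ← abs_pow, abs_of_nonneg (Even.pow_nonneg (by decide) (w y))]
  have hd' : ∫ y, ‖fderiv ℝ w y‖ ^ (2 : ℝ) = d := by
    refine integral_congr_ae (ae_of_all _ fun y => ?_)
    show ‖fderiv ℝ w y‖ ^ (2 : ℝ) = ‖fderiv ℝ w y‖ ^ 2
    exact Real.rpow_two _
  have h4 : eLpNorm w 4 (volume : Measure E) = ENNReal.ofReal (a ^ (4 : ℝ)⁻¹) := by
    rw [hw4.eLpNorm_eq_integral_rpow_norm (by norm_num) (by norm_num)]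
    simp only [ENNReal.toReal_ofNat]
    rw [ha']
  have h2 : eLpNorm (fderiv ℝ w) 2 (volume : Measure E) = ENNReal.ofReal (d ^ (2 : ℝ)⁻¹) := by
    rw [hdw.eLpNorm_eq_integral_rpow_norm (by norm_num) (by norm_num)]
    simp only [ENNReal.toReal_ofNat]
    rw [hd']
  rw [h4, h2, ← ENNReal.ofReal_coe_nnreal, ← ENNReal.ofReal_mul (NNReal.coe_nonneg C)] at h
  have hreal : a ^ (4 : ℝ)⁻¹ ≤ C * d ^ (2 : ℝ)⁻¹ := (ENNReal.ofReal_le_ofReal_iff (by positivity)).mp h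
  -- square: `√a = (a^{1/4})²` and `(d^{1/2})² = d`
  have hsq_a : (a ^ (4 : ℝ)⁻¹) ^ 2 = Real.sqrt a := by
    rw [← Real.rpow_natCast, ← Real.rpow_mul ha0, Real.sqrt_eq_rpow]
    norm_num
  have hsq_d : (d ^ (2 : ℝ)⁻¹) ^ 2 = d := by
    rw [← Real.rpow_natCast, ← Real.rpow_mul hd0]
    norm_num
  calc Real.sqrt a = (a ^ (4 : ℝ)⁻¹) ^ 2 := hsq_a.symm
    _ ≤ (C * d ^ (2 : ℝ)⁻¹) ^ 2 := pow_le_pow_left₀ (by positivity) hreal 2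
    _ = (C : ℝ) ^ 2 * d := by rw [mul_pow, hsq_d]
    _ ≤ ((C : ℝ) ^ 2 + 1) * d := by nlinarith

/-- **Cauchy–Schwarz on a set**: `∫_V w² ≤ √|V| √(∫ w⁴)` for continuous compactly supported `w`
and `V` measurable of finite volume. [folklore] -/
theorem setIntegral_sq_le_sqrt_measure_mul_sqrt {w : E → ℝ} (hw : Continuous w)
    (hwc : HasCompactSupport w) {V : Set E} (hVfin : volume V < ⊤) :
    ∫ y in V, w y ^ 2 ≤ Real.sqrt ((volume V).toReal) * Real.sqrt (∫ y, w y ^ 4) := by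
  have hpowc : ∀ n : ℕ, n ≠ 0 → HasCompactSupport fun y => w y ^ n := fun n hn =>
    hwc.mono fun y hy => by
      simp only [Function.mem_support, ne_eq] at hy ⊢
      exact fun h0 => hy (by rw [h0, zero_pow hn])
  have hI4 : Integrable fun y => w y ^ 4 := (hw.pow 4).integrable_of_hasCompactSupport
    (hpowc 4 (by norm_num))
  have hI2V : IntegrableOn (fun y => w y ^ 2) V := ((hw.pow 2).integrable_of_hasCompactSupport
    (hpowc 2 (by norm_num))).integrableOn
  have hA : 0 ≤ (volume V).toReal := ENNReal.toReal_nonneg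
  have hB : 0 ≤ ∫ y, w y ^ 4 := integral_nonneg fun y => by show (0 : ℝ) ≤ w y ^ 4; positivity
  refine Literature.Analysis.Calculus.le_sqrt_mul_sqrt_of_forall_pos hA hB fun lam hlam => ?_
  have hpt : ∀ y, 2 * w y ^ 2 ≤ lam * 1 + w y ^ 4 / lam := by
    intro y
    have h := two_mul_le_add_sq (Real.sqrt lam) (w y ^ 2 / Real.sqrt lam)
    have hl : Real.sqrt lam ≠ 0 := (Real.sqrt_pos.mpr hlam).ne'
    calc 2 * w y ^ 2 = 2 * Real.sqrt lam * (w y ^ 2 / Real.sqrt lam) := by field_simp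
      _ ≤ Real.sqrt lam ^ 2 + (w y ^ 2 / Real.sqrt lam) ^ 2 := h
      _ = lam * 1 + w y ^ 4 / lam := by rw [div_pow, Real.sq_sqrt hlam.le]; ring
  haveI : IsFiniteMeasure (volume.restrict V) :=
    ⟨by rw [Measure.restrict_apply_univ]; exact hVfin⟩
  have hI4V : IntegrableOn (fun y => w y ^ 4 / lam) V := (hI4.div_const lam).integrableOn
  calc 2 * ∫ y in V, w y ^ 2 = ∫ y in V, 2 * w y ^ 2 := (integral_const_mul _ _).symm
    _ ≤ ∫ y in V, (lam * 1 + w y ^ 4 / lam) :=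
        integral_mono (hI2V.const_mul 2) ((integrable_const _).add hI4V) hpt
    _ = lam * (volume V).toReal + (∫ y in V, w y ^ 4) / lam := by
        rw [integral_add (integrable_const _) hI4V, integral_div, setIntegral_const, smul_eq_mul,
          measureReal_def]
        ring
    _ ≤ lam * (volume V).toReal + (∫ y, w y ^ 4) / lam := by
        have h := setIntegral_le_integral (s := V) hI4 (ae_of_all _ fun y =>
          show (0 : ℝ) ≤ w y ^ 4 from Even.pow_nonneg (by decide) (w y))
        have h' := div_le_div_of_nonneg_right h hlam.le
        linarith

end Sobolev

/-! ### Pointwise estimates for the energy density of a smooth connection -/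

section Pointwise

open scoped Matrix.Norms.Frobenius

attribute [local instance] frobeniusInnerProductSpace

variable {m : Type*} [Fintype m] [DecidableEq m]
variable {E : Type*} [NormedAddCommGroup E] [InnerProductSpace ℝ E] [FiniteDimensional ℝ E]
variable {ι : Type*} [Fintype ι] [LinearOrder ι]

/-- Finite differentiability orders are below `∞`. [folklore] -/
private theorem natCast_le_infty₄ (n : ℕ) : (n : WithTop ℕ∞) ≤ (⊤ : ℕ∞) := by
  exact_mod_cast le_top

omit [FiniteDimensional ℝ E] [LinearOrder ι] in
/-- **Cauchy–Schwarz for a double sum of inner products**: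
`|∑_{jk} ⟨F_{jk}, G_{jk}⟩| ≤ √(∑_{jk}‖F_{jk}‖²) √(∑_{jk}‖G_{jk}‖²)`. [folklore] -/
theorem abs_sum_sum_inner_le_sqrt_mul_sqrt {V : Type*} [NormedAddCommGroup V]
    [InnerProductSpace ℝ V] (F G : ι → ι → V) :
    |∑ j, ∑ k, ⟪F j k, G j k⟫| ≤
      Real.sqrt (∑ j, ∑ k, ‖F j k‖ ^ 2) * Real.sqrt (∑ j, ∑ k, ‖G j k‖ ^ 2) := by
  calc |∑ j, ∑ k, ⟪F j k, G j k⟫| ≤ ∑ j, |∑ k, ⟪F j k, G j k⟫| := Finset.abs_sum_le_sum_abs _ _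
    _ ≤ ∑ j, ∑ k, ‖F j k‖ * ‖G j k‖ := Finset.sum_le_sum fun j _ =>
        (Finset.abs_sum_le_sum_abs _ _).trans
          (Finset.sum_le_sum fun k _ => abs_real_inner_le_norm _ _)
    _ ≤ ∑ j, Real.sqrt (∑ k, ‖F j k‖ ^ 2) * Real.sqrt (∑ k, ‖G j k‖ ^ 2) :=
        Finset.sum_le_sum fun j _ => Real.sum_mul_le_sqrt_mul_sqrt _ _ _
    _ ≤ Real.sqrt (∑ j, ∑ k, ‖F j k‖ ^ 2) * Real.sqrt (∑ j, ∑ k, ‖G j k‖ ^ 2) :=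
        Real.sum_sqrt_mul_sqrt_le _ (fun j => Finset.sum_nonneg fun k _ => by positivity)
          (fun j => Finset.sum_nonneg fun k _ => by positivity)

/-- **Kato-type bound for the gradient of the energy density**: for a `C²` `𝔲(m)`-valued
connection, `‖De(y)‖² ≤ 2 e(y) ∑_{ijk}‖DᵢF_{jk}(y)‖²` (`∂ᵢe = ∑_{jk}⟨F_{jk}, DᵢF_{jk}⟩` and
Cauchy–Schwarz; `|∇|F|²|² ≤ 4|F|²|∇F|²`). [folklore] -/
theorem norm_fderiv_ymDensityOfBasis_sq_le (b : OrthonormalBasis ι ℝ E)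
    {A : Connection E (Matrix m m ℂ)} (hA : ContDiff ℝ 2 A)
    (hval : A.IsValuedIn (skewAdjoint.submodule ℝ (Matrix m m ℂ))) (y : E) :
    ‖fderiv ℝ (fun z => ymDensityOfBasis b A z) y‖ ^ 2 ≤
      2 * ymDensityOfBasis b A y *
        ∑ i, ∑ j, ∑ k, ‖covDeriv A (fun z => curvature A z (b j) (b k)) y (b i)‖ ^ 2 := by
  rw [← sum_sq_apply_orthonormalBasis_eq b, Finset.mul_sum]
  refine Finset.sum_le_sum fun i _ => ?_
  rw [fderiv_ymDensityOfBasis_eq b hA y (b i) (hval y (b i))]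
  set F : ι → ι → Matrix m m ℂ := fun j k => curvature A y (b j) (b k) with hF
  set G : ι → ι → Matrix m m ℂ := fun j k =>
    covDeriv A (fun z => curvature A z (b j) (b k)) y (b i) with hG
  have h : |∑ j, ∑ k, ⟪F j k, G j k⟫| ≤
      Real.sqrt (∑ j, ∑ k, ‖F j k‖ ^ 2) * Real.sqrt (∑ j, ∑ k, ‖G j k‖ ^ 2) :=
    abs_sum_sum_inner_le_sqrt_mul_sqrt F G
  have he : ∑ j, ∑ k, ‖F j k‖ ^ 2 = 2 * ymDensityOfBasis b A y := by
    rw [ymDensityOfBasis_eq_half_sum b A y]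
    ring
  have hF0 : 0 ≤ ∑ j, ∑ k, ‖F j k‖ ^ 2 := Finset.sum_nonneg fun j _ =>
    Finset.sum_nonneg fun k _ => by positivity
  have hG0 : 0 ≤ ∑ j, ∑ k, ‖G j k‖ ^ 2 := Finset.sum_nonneg fun j _ =>
    Finset.sum_nonneg fun k _ => by positivity
  have h' := pow_le_pow_left₀ (abs_nonneg _) h 2
  rw [sq_abs, mul_pow, Real.sq_sqrt hF0, Real.sq_sqrt hG0, he] at h'
  exact h'

omit [DecidableEq m] [Fintype m] [FiniteDimensional ℝ E] [Fintype ι] [LinearOrder ι] in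
/-- `‖a + c‖² ≤ 2‖a‖² + 2‖c‖²`. [folklore] -/
theorem norm_add_sq_le_two_mul {V : Type*} [NormedAddCommGroup V] (a c : V) :
    ‖a + c‖ ^ 2 ≤ 2 * ‖a‖ ^ 2 + 2 * ‖c‖ ^ 2 := by
  have h := norm_add_le a c
  nlinarith [norm_nonneg (a + c), norm_nonneg a, norm_nonneg c, sq_nonneg (‖a‖ - ‖c‖)]

/-- **Gradient of the Sobolev test function `w = φ √(e + δ²)`**: for a `C²` `𝔲(m)`-valued
connection, `φ ∈ C¹` and `δ > 0`,
`‖Dw‖² ≤ 2 (e + δ²) ‖Dφ‖² + φ² ∑_{ijk}‖DᵢF_{jk}‖²` (chain rule and the Kato-type bound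
`‖De‖² ≤ 2e ∑‖DᵢF_{jk}‖²`). [folklore] -/
theorem norm_fderiv_mul_sqrt_sq_le (b : OrthonormalBasis ι ℝ E)
    {A : Connection E (Matrix m m ℂ)} (hA : ContDiff ℝ 2 A)
    (hval : A.IsValuedIn (skewAdjoint.submodule ℝ (Matrix m m ℂ)))
    {φ : E → ℝ} (hφ : ContDiff ℝ 1 φ) {δ : ℝ} (hδ : 0 < δ) (y : E) :
    ‖fderiv ℝ (fun z => φ z * Real.sqrt (ymDensityOfBasis b A z + δ ^ 2)) y‖ ^ 2 ≤
      2 * (ymDensityOfBasis b A y + δ ^ 2) * ‖fderiv ℝ φ y‖ ^ 2 +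
        φ y ^ 2 * ∑ i, ∑ j, ∑ k, ‖covDeriv A (fun z => curvature A z (b j) (b k)) y (b i)‖ ^ 2 := by
  set e : E → ℝ := fun z => ymDensityOfBasis b A z with he
  set N : ℝ := ∑ i, ∑ j, ∑ k, ‖covDeriv A (fun z => curvature A z (b j) (b k)) y (b i)‖ ^ 2
    with hN
  have hA11 : ContDiff ℝ (1 + 1) A := by rw [show (1 : WithTop ℕ∞) + 1 = 2 by norm_num]; exact hA
  have hed : Differentiable ℝ e := (contDiff_ymDensityOfBasis b hA11).differentiable one_ne_zero
  have he0 : ∀ z, 0 ≤ e z := fun z => ymDensityOfBasis_nonneg b A z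
  have hpos : 0 < e y + δ ^ 2 := by positivity [he0 y]
  set g : E → ℝ := fun z => Real.sqrt (e z + δ ^ 2) with hg
  have hgy : g y = Real.sqrt (e y + δ ^ 2) := rfl
  have hg' : HasFDerivAt g ((1 / (2 * Real.sqrt (e y + δ ^ 2))) • fderiv ℝ e y) y := by
    have h := ((hed y).hasFDerivAt.add_const (δ ^ 2)).sqrt hpos.ne'
    exact h
  have hφ' : HasFDerivAt φ (fderiv ℝ φ y) y := (hφ.differentiable one_ne_zero y).hasFDerivAt
  have hw : HasFDerivAt (fun z => φ z * g z)
      (φ y • ((1 / (2 * Real.sqrt (e y + δ ^ 2))) • fderiv ℝ e y) + g y • fderiv ℝ φ y) y :=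
    hφ'.mul hg'
  rw [hw.fderiv]
  -- the two pieces
  have hN0 : 0 ≤ N := Finset.sum_nonneg fun i _ => Finset.sum_nonneg fun j _ =>
    Finset.sum_nonneg fun k _ => by positivity
  have hkato : ‖fderiv ℝ e y‖ ^ 2 ≤ 2 * e y * N := norm_fderiv_ymDensityOfBasis_sq_le b hA hval y
  have h1 : ‖φ y • ((1 / (2 * Real.sqrt (e y + δ ^ 2))) • fderiv ℝ e y)‖ ^ 2 ≤ φ y ^ 2 * N / 2 := by
    rw [norm_smul, norm_smul, Real.norm_eq_abs, Real.norm_eq_abs, mul_pow, mul_pow, sq_abs, sq_abs,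
      div_pow, one_pow, mul_pow, Real.sq_sqrt hpos.le]
    have hfrac : 1 / (2 ^ 2 * (e y + δ ^ 2)) * ‖fderiv ℝ e y‖ ^ 2 ≤ N / 2 := by
      rw [div_mul_eq_mul_div, one_mul, div_le_div_iff₀ (by positivity) (by norm_num : (0:ℝ) < 2)]
      nlinarith [hkato, he0 y, sq_nonneg δ, hN0]
    calc φ y ^ 2 * (1 / (2 ^ 2 * (e y + δ ^ 2)) * ‖fderiv ℝ e y‖ ^ 2)
        ≤ φ y ^ 2 * (N / 2) := mul_le_mul_of_nonneg_left hfrac (sq_nonneg _)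
      _ = φ y ^ 2 * N / 2 := by ring
  have h2 : ‖g y • fderiv ℝ φ y‖ ^ 2 = (e y + δ ^ 2) * ‖fderiv ℝ φ y‖ ^ 2 := by
    rw [norm_smul, mul_pow, hgy, Real.norm_eq_abs, sq_abs, Real.sq_sqrt hpos.le]
  calc ‖φ y • ((1 / (2 * Real.sqrt (e y + δ ^ 2))) • fderiv ℝ e y) + g y • fderiv ℝ φ y‖ ^ 2
      ≤ 2 * ‖φ y • ((1 / (2 * Real.sqrt (e y + δ ^ 2))) • fderiv ℝ e y)‖ ^ 2 +
          2 * ‖g y • fderiv ℝ φ y‖ ^ 2 := norm_add_sq_le_two_mul _ _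
    _ ≤ 2 * (φ y ^ 2 * N / 2) + 2 * ((e y + δ ^ 2) * ‖fderiv ℝ φ y‖ ^ 2) := by
        rw [h2]; linarith [h1]
    _ = 2 * (e y + δ ^ 2) * ‖fderiv ℝ φ y‖ ^ 2 + φ y ^ 2 * N := by ring

end Pointwise

/-! ### Integral estimates at a fixed time -/

section FixedTime

open scoped Matrix.Norms.Frobenius

attribute [local instance] frobeniusInnerProductSpace

variable {m : Type*} [Fintype m] [DecidableEq m]
variable {E : Type*} [NormedAddCommGroup E] [InnerProductSpace ℝ E] [FiniteDimensional ℝ E]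
  [MeasurableSpace E] [BorelSpace E]
variable {ι : Type*} [Fintype ι] [LinearOrder ι]

omit [DecidableEq m] [Fintype m] [InnerProductSpace ℝ E] [FiniteDimensional ℝ E] [MeasurableSpace E]
  [BorelSpace E] [LinearOrder ι] [Fintype ι] in
/-- Squares of compactly supported real functions are compactly supported. [folklore] -/
theorem hasCompactSupport_sq {f : E → ℝ} (hf : HasCompactSupport f) :
    HasCompactSupport fun y => f y ^ 2 :=
  hf.mono fun y hy => by
    simp only [Function.mem_support, ne_eq] at hy ⊢
    exact fun h0 => hy (by rw [h0]; norm_num)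

omit [DecidableEq m] [Fintype m] [InnerProductSpace ℝ E] [FiniteDimensional ℝ E] [MeasurableSpace E]
  [BorelSpace E] [LinearOrder ι] [Fintype ι] in
/-- Squared norms of compactly supported functions are compactly supported. [folklore] -/
theorem hasCompactSupport_norm_sq {W : Type*} [NormedAddCommGroup W] {f : E → W}
    (hf : HasCompactSupport f) : HasCompactSupport fun y => ‖f y‖ ^ 2 :=
  hf.norm.mono fun y hy => by
    simp only [Function.mem_support, ne_eq] at hy ⊢
    exact fun h0 => hy (by rw [h0]; norm_num)

/-- **Young's inequality step**: `2 |φ| ‖Dφ‖ √(2 e N) ≤ ½ φ² N + 4 e ‖Dφ‖²` (`e, N ≥ 0`).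
[folklore] -/
theorem two_mul_abs_mul_norm_mul_sqrt_le (φy K e N : ℝ) (he : 0 ≤ e) (hN : 0 ≤ N) :
    2 * |φy| * K * Real.sqrt (2 * e * N) ≤ 1 / 2 * φy ^ 2 * N + 4 * e * K ^ 2 := by
  have hsplit : Real.sqrt (2 * e * N) = Real.sqrt (2 * e) * Real.sqrt N :=
    Real.sqrt_mul (by positivity) N
  rw [hsplit]
  set a : ℝ := |φy| * Real.sqrt N with ha
  set c : ℝ := K * Real.sqrt (2 * e) with hc
  have ha2 : a ^ 2 = φy ^ 2 * N := by rw [ha, mul_pow, sq_abs, Real.sq_sqrt hN]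
  have hc2 : c ^ 2 = K ^ 2 * (2 * e) := by rw [hc, mul_pow, Real.sq_sqrt (by positivity)]
  have key : 2 * a * c ≤ 1 / 2 * a ^ 2 + 2 * c ^ 2 := by nlinarith [sq_nonneg (a - 2 * c)]
  calc 2 * |φy| * K * (Real.sqrt (2 * e) * Real.sqrt N) = 2 * a * c := by rw [ha, hc]; ring
    _ ≤ 1 / 2 * a ^ 2 + 2 * c ^ 2 := key
    _ = 1 / 2 * φy ^ 2 * N + 4 * e * K ^ 2 := by rw [ha2, hc2]; ring

omit [DecidableEq m] [Fintype m] [LinearOrder ι] [Fintype ι] in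
/-- **Cauchy–Schwarz with a square root**: for nonnegative continuous `f, g` with `f = 0` off a
measurable `V` contained in a compact set, `∫ f √g ≤ √(∫ f²) √(∫_V g)`. [folklore] -/
theorem integral_mul_sqrt_le_sqrt_mul_sqrt {f g : E → ℝ} (hf : Continuous f) (hg : Continuous g)
    (hg0 : ∀ y, 0 ≤ g y) {K V : Set E} (hK : IsCompact K) (hVK : V ⊆ K)
    (hV : MeasurableSet V) (hfV : ∀ y ∉ V, f y = 0) :
    ∫ y, f y * Real.sqrt (g y) ≤ Real.sqrt (∫ y, f y ^ 2) * Real.sqrt (∫ y in V, g y) := by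
  -- `f` has compact support
  have hfc : HasCompactSupport f := by
    refine IsCompact.of_isClosed_subset hK (isClosed_tsupport f) ?_
    refine closure_minimal (fun y hy => hVK ?_) hK.isClosed
    by_contra h
    exact hy (hfV y h)
  have hfc2 : HasCompactSupport fun y => f y ^ 2 := hfc.mono fun y hy => by
    simp only [Function.mem_support, ne_eq] at hy ⊢
    exact fun h0 => hy (by rw [h0]; norm_num)
  have hfgc : HasCompactSupport fun y => f y * Real.sqrt (g y) := hfc.mul_right
  have hIf2 : Integrable fun y => f y ^ 2 := (hf.pow 2).integrable_of_hasCompactSupport hfc2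
  have hIfg : Integrable fun y => f y * Real.sqrt (g y) :=
    (hf.mul (Real.continuous_sqrt.comp hg)).integrable_of_hasCompactSupport hfgc
  have hIgV : IntegrableOn g V := (hg.continuousOn.integrableOn_compact hK).mono_set hVK
  have hA : 0 ≤ ∫ y, f y ^ 2 := integral_nonneg fun y => by positivity
  have hB : 0 ≤ ∫ y in V, g y := setIntegral_nonneg hV fun y _ => hg0 y
  refine Literature.Analysis.Calculus.le_sqrt_mul_sqrt_of_forall_pos hA hB fun lam hlam => ?_
  have hpt : ∀ y, 2 * (f y * Real.sqrt (g y)) ≤ lam * f y ^ 2 + V.indicator g y / lam := by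
    intro y
    by_cases hy : y ∈ V
    · rw [indicator_of_mem hy]
      have h := two_mul_le_add_sq (Real.sqrt lam * f y) (Real.sqrt (g y) / Real.sqrt lam)
      have hl : Real.sqrt lam ≠ 0 := (Real.sqrt_pos.mpr hlam).ne'
      calc 2 * (f y * Real.sqrt (g y))
          = 2 * (Real.sqrt lam * f y) * (Real.sqrt (g y) / Real.sqrt lam) := by field_simp
        _ ≤ (Real.sqrt lam * f y) ^ 2 + (Real.sqrt (g y) / Real.sqrt lam) ^ 2 := h
        _ = lam * f y ^ 2 + g y / lam := by
            rw [mul_pow, div_pow, Real.sq_sqrt hlam.le, Real.sq_sqrt (hg0 y)]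
    · rw [indicator_of_notMem hy, hfV y hy]
      simp
  have hIind : Integrable fun y => V.indicator g y / lam := by
    refine Integrable.div_const ?_ lam
    exact (integrable_indicator_iff hV).mpr hIgV
  calc 2 * ∫ y, f y * Real.sqrt (g y) = ∫ y, 2 * (f y * Real.sqrt (g y)) :=
        (integral_const_mul _ _).symm
    _ ≤ ∫ y, (lam * f y ^ 2 + V.indicator g y / lam) :=
        integral_mono (hIfg.const_mul 2) ((hIf2.const_mul lam).add hIind) hpt
    _ = lam * (∫ y, f y ^ 2) + (∫ y in V, g y) / lam := by
        rw [integral_add (hIf2.const_mul lam) hIind, integral_const_mul, integral_div,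
          integral_indicator hV]

/-- **Testing the Laplacian of the energy density against `φ²`** (the integration by parts of
Waldron's proof of Prop. 3.4, "multiplying by `φ²v` and integrating by parts"): for a smooth
`𝔲(m)`-valued connection and `φ ∈ C¹_c`,
`∫ φ² ∑ᵢ∂ᵢ∂ᵢe ≤ ∫ (½ φ² N + 4 e ‖Dφ‖²)` with `N = ∑_{ijk}‖DᵢF_{jk}‖²`
(`∫φ²Δe = −2∫φ ∑ᵢ∂ᵢφ ∂ᵢe`, `‖De‖ ≤ √(2eN)` and Young's inequality).
[cite: Waldron2019, proof of Prop. 3.4] -/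
theorem integral_sq_mul_laplacian_ymDensity_le (b : OrthonormalBasis ι ℝ E)
    {A : Connection E (Matrix m m ℂ)} (hA : ContDiff ℝ ∞ A)
    (hval : A.IsValuedIn (skewAdjoint.submodule ℝ (Matrix m m ℂ)))
    {φ : E → ℝ} (hφ : ContDiff ℝ 1 φ) (hφc : HasCompactSupport φ) :
    ∫ y, φ y ^ 2 * ∑ i, fderiv ℝ (fun z => fderiv ℝ (fun x => ymDensityOfBasis b A x) z (b i)) y
        (b i) ≤
      ∫ y, (1 / 2 * φ y ^ 2 *
          ∑ i, ∑ j, ∑ k, ‖covDeriv A (fun z => curvature A z (b j) (b k)) y (b i)‖ ^ 2 +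
        4 * ymDensityOfBasis b A y * ‖fderiv ℝ φ y‖ ^ 2) := by
  -- regularity
  have hA2 : ContDiff ℝ 2 A := hA.of_le (natCast_le_infty₄ 2)
  have hA21 : ContDiff ℝ (2 + 1) A := hA.of_le (natCast_le_infty₄ 3)
  have hA02 : ContDiff ℝ (0 + 2) A := hA.of_le (natCast_le_infty₄ 2)
  set e : E → ℝ := fun x => ymDensityOfBasis b A x with he
  have he2 : ContDiff ℝ 2 e := contDiff_ymDensityOfBasis b hA21
  have hf : ∀ i, ContDiff ℝ 1 fun z => fderiv ℝ e z (b i) := fun i =>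
    (he2.fderiv_right (m := 1) (by norm_num)).clm_apply contDiff_const
  set N : E → ℝ := fun y =>
    ∑ i, ∑ j, ∑ k, ‖covDeriv A (fun z => curvature A z (b j) (b k)) y (b i)‖ ^ 2 with hN
  have hNc : Continuous N := by
    refine continuous_finsetSum _ fun i _ => continuous_finsetSum _ fun j _ =>
      continuous_finsetSum _ fun k _ => ?_
    exact ((contDiff_covDeriv_curvature_apply hA02 (b j) (b k) (b i)).continuous).norm.pow 2
  have hN0 : ∀ y, 0 ≤ N y := fun y => Finset.sum_nonneg fun i _ => Finset.sum_nonneg fun j _ =>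
    Finset.sum_nonneg fun k _ => by positivity
  have he0 : ∀ y, 0 ≤ e y := fun y => ymDensityOfBasis_nonneg b A y
  have hec : Continuous e := he2.continuous
  -- the test function `χ = φ²`
  have hχ : ContDiff ℝ 1 fun y => φ y ^ 2 := hφ.pow 2
  have hχc : HasCompactSupport fun y => φ y ^ 2 := hφc.mono fun y hy => by
    simp only [Function.mem_support, ne_eq] at hy ⊢
    exact fun h0 => hy (by rw [h0]; norm_num)
  have hdχ : ∀ y i, fderiv ℝ (fun y => φ y ^ 2) y (b i) = 2 * φ y * fderiv ℝ φ y (b i) := by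
    intro y i
    rw [((hφ.differentiable one_ne_zero y).hasFDerivAt.pow 2).fderiv]
    simp only [smul_apply, nsmul_eq_mul, Nat.cast_ofNat, smul_eq_mul, Nat.add_one_sub_one, pow_one]
  -- integration by parts
  rw [integral_mul_sum_fderiv_eq_neg_integral (fun i => b i) hχ hχc hf]
  simp_rw [hdχ]
  rw [← integral_neg]
  -- pointwise bound on the flux
  have hpt : ∀ y, -(∑ i, fderiv ℝ e y (b i) * (2 * φ y * fderiv ℝ φ y (b i))) ≤
      1 / 2 * φ y ^ 2 * N y + 4 * e y * ‖fderiv ℝ φ y‖ ^ 2 := by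
    intro y
    have hsum : ∑ i, fderiv ℝ e y (b i) * (2 * φ y * fderiv ℝ φ y (b i)) =
        2 * φ y * ∑ i, fderiv ℝ e y (b i) * fderiv ℝ φ y (b i) := by
      rw [Finset.mul_sum]
      exact Finset.sum_congr rfl fun i _ => by ring
    have hcs : |∑ i, fderiv ℝ e y (b i) * fderiv ℝ φ y (b i)| ≤ ‖fderiv ℝ e y‖ * ‖fderiv ℝ φ y‖ := by
      have h := Real.sum_mul_le_sqrt_mul_sqrt Finset.univ (fun i => fderiv ℝ e y (b i))
        (fun i => fderiv ℝ φ y (b i))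
      have h' := Real.sum_mul_le_sqrt_mul_sqrt Finset.univ (fun i => -fderiv ℝ e y (b i))
        (fun i => fderiv ℝ φ y (b i))
      simp only [neg_mul, Finset.sum_neg_distrib, even_two, Even.neg_pow] at h'
      rw [sum_sq_apply_orthonormalBasis_eq b, sum_sq_apply_orthonormalBasis_eq b,
        Real.sqrt_sq (norm_nonneg _), Real.sqrt_sq (norm_nonneg _)] at h h'
      exact abs_le.mpr ⟨by linarith, h⟩
    have hkato : ‖fderiv ℝ e y‖ ≤ Real.sqrt (2 * e y * N y) := by
      rw [← Real.sqrt_sq (norm_nonneg (fderiv ℝ e y))]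
      exact Real.sqrt_le_sqrt (norm_fderiv_ymDensityOfBasis_sq_le b hA2 hval y)
    have hyoung := two_mul_abs_mul_norm_mul_sqrt_le (φ y) ‖fderiv ℝ φ y‖ (e y) (N y)
      (he0 y) (hN0 y)
    rw [hsum]
    calc -(2 * φ y * ∑ i, fderiv ℝ e y (b i) * fderiv ℝ φ y (b i))
        ≤ |2 * φ y * ∑ i, fderiv ℝ e y (b i) * fderiv ℝ φ y (b i)| := neg_le_abs _
      _ = 2 * |φ y| * |∑ i, fderiv ℝ e y (b i) * fderiv ℝ φ y (b i)| := by
          rw [abs_mul, abs_mul, abs_two]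
      _ ≤ 2 * |φ y| * (‖fderiv ℝ e y‖ * ‖fderiv ℝ φ y‖) :=
          mul_le_mul_of_nonneg_left hcs (by positivity)
      _ ≤ 2 * |φ y| * (Real.sqrt (2 * e y * N y) * ‖fderiv ℝ φ y‖) := by
          gcongr
      _ = 2 * |φ y| * ‖fderiv ℝ φ y‖ * Real.sqrt (2 * e y * N y) := by ring
      _ ≤ 1 / 2 * φ y ^ 2 * N y + 4 * e y * ‖fderiv ℝ φ y‖ ^ 2 := hyoung
  -- integrability and conclusion
  have hdφc : ∀ i, Continuous fun y => fderiv ℝ φ y (b i) := fun i =>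
    (hφ.continuous_fderiv one_ne_zero).clm_apply continuous_const
  have hdec : ∀ i, Continuous fun y => fderiv ℝ e y (b i) := fun i => (hf i).continuous
  have hI1 : Integrable fun y => -(∑ i, fderiv ℝ e y (b i) * (2 * φ y * fderiv ℝ φ y (b i))) := by
    refine Integrable.neg (integrable_finsetSum _ fun i _ => ?_)
    have hc : Continuous fun y => fderiv ℝ e y (b i) * (2 * φ y * fderiv ℝ φ y (b i)) :=
      (hdec i).mul ((continuous_const.mul hφ.continuous).mul (hdφc i))
    exact hc.integrable_of_hasCompactSupport
      (((hφc.fderiv_apply (𝕜 := ℝ) (b i)).mul_left).mul_left)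
  have hI2 : Integrable fun y => 1 / 2 * φ y ^ 2 * N y + 4 * e y * ‖fderiv ℝ φ y‖ ^ 2 := by
    refine Integrable.add ?_ ?_
    · have hc : Continuous fun y => 1 / 2 * φ y ^ 2 * N y :=
        (continuous_const.mul (hφ.continuous.pow 2)).mul hNc
      exact hc.integrable_of_hasCompactSupport ((hχc.mul_left).mul_right)
    · have hc : Continuous fun y => 4 * e y * ‖fderiv ℝ φ y‖ ^ 2 :=
        (continuous_const.mul hec).mul ((hφ.continuous_fderiv one_ne_zero).norm.pow 2)
      have hsupp : HasCompactSupport fun y => ‖fderiv ℝ φ y‖ ^ 2 :=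
        (hφc.fderiv (𝕜 := ℝ)).norm.mono fun y hy => by
          simp only [Function.mem_support, ne_eq] at hy ⊢
          exact fun h0 => hy (by rw [h0]; norm_num)
      exact hc.integrable_of_hasCompactSupport hsupp.mul_left
  exact integral_mono hI1 hI2 hpt

/-- **The differential inequality for the localized energy, at a fixed time** (the analytic
core of Waldron's proof of Prop. 3.4, flat case). Let `A` be a smooth `𝔲(m)`-valued connection
with density `e`, `N = ∑_{ijk}‖DᵢF_{jk}‖²`, and let `ė` be a continuous function with
`ė ≤ ∑ᵢ∂ᵢ∂ᵢe − N + A₃ e^{3/2}` pointwise (for the flow: the Bochner inequality). Let `φ ∈ C¹_c`,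
`0 ≤ φ ≤ 1`, `φ = 0` off `V`, `Dφ = 0` off `U`, `‖Dφ‖ ≤ K` (`U, V` bounded measurable), and let
`C_S` be a Sobolev constant (`√(∫w⁴) ≤ C_S∫‖Dw‖²` on `C¹_c`). If
`κ = 1/(2C_S) − A₃ √(∫_V e) ≥ 0` then
`∫ φ² ė ≤ −(κ/√|V|) ∫ φ² e + 5 K² ∫_U e`.
Proof as printed (with `e = v²`): `∫φ²Δe ≤ ½∫φ²N + 4∫e‖Dφ‖²`; Sobolev for `w = φ√(e+δ²)`,
`‖Dw‖² ≤ 2(e+δ²)‖Dφ‖² + φ²N`; Hölder `∫φ²e^{3/2} ≤ √(∫w⁴)√(∫_V e)` and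
`∫φ²e ≤ √|V| √(∫w⁴)`; then `δ → 0`. [cite: Waldron2019, proof of Prop. 3.4] -/
theorem integral_sq_mul_le_of_subsolution (b : OrthonormalBasis ι ℝ E)
    {A : Connection E (Matrix m m ℂ)} (hA : ContDiff ℝ ∞ A)
    (hval : A.IsValuedIn (skewAdjoint.submodule ℝ (Matrix m m ℂ)))
    {φ : E → ℝ} (hφ : ContDiff ℝ 1 φ) (hφc : HasCompactSupport φ) (hφ01 : ∀ y, 0 ≤ φ y ∧ φ y ≤ 1)
    {Kc V U : Set E} (hKc : IsCompact Kc) (hVK : V ⊆ Kc) (hV : MeasurableSet V) (hUK : U ⊆ Kc)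
    (hU : MeasurableSet U) (hφV : ∀ y ∉ V, φ y = 0) (hφU : ∀ y ∉ U, fderiv ℝ φ y = 0)
    {K : ℝ} (hK : ∀ y, ‖fderiv ℝ φ y‖ ≤ K)
    {Cs : ℝ} (hCs : 0 < Cs) (hSob : ∀ w : E → ℝ, ContDiff ℝ 1 w → HasCompactSupport w →
      Real.sqrt (∫ y, w y ^ 4) ≤ Cs * ∫ y, ‖fderiv ℝ w y‖ ^ 2)
    {A₃ : ℝ} (hA₃ : 0 ≤ A₃) {dte : E → ℝ} (hdte : Continuous dte)
    (hineq : ∀ y, dte y ≤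
      (∑ i, fderiv ℝ (fun z => fderiv ℝ (fun x => ymDensityOfBasis b A x) z (b i)) y (b i)) -
        (∑ i, ∑ j, ∑ k, ‖covDeriv A (fun z => curvature A z (b j) (b k)) y (b i)‖ ^ 2) +
        A₃ * ymDensityOfBasis b A y * Real.sqrt (ymDensityOfBasis b A y))
    (hκ : 0 ≤ 1 / (2 * Cs) - A₃ * Real.sqrt (∫ y in V, ymDensityOfBasis b A y)) :
    ∫ y, φ y ^ 2 * dte y ≤
      -((1 / (2 * Cs) - A₃ * Real.sqrt (∫ y in V, ymDensityOfBasis b A y)) /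
          Real.sqrt ((volume V).toReal)) * (∫ y, φ y ^ 2 * ymDensityOfBasis b A y) +
        5 * K ^ 2 * ∫ y in U, ymDensityOfBasis b A y := by
  -- regularity of the players
  have hA2 : ContDiff ℝ 2 A := hA.of_le (natCast_le_infty₄ 2)
  have hA21 : ContDiff ℝ (2 + 1) A := hA.of_le (natCast_le_infty₄ 3)
  have hA02 : ContDiff ℝ (0 + 2) A := hA.of_le (natCast_le_infty₄ 2)
  set e : E → ℝ := ymDensityOfBasis b A with he
  set N : E → ℝ := fun y =>
    ∑ i, ∑ j, ∑ k, ‖covDeriv A (fun z => curvature A z (b j) (b k)) y (b i)‖ ^ 2 with hN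
  set Δe : E → ℝ := fun y => ∑ i, fderiv ℝ (fun z => fderiv ℝ e z (b i)) y (b i) with hΔe
  have he2 : ContDiff ℝ 2 e := contDiff_ymDensityOfBasis b hA21
  have hec : Continuous e := he2.continuous
  have he0 : ∀ y, 0 ≤ e y := fun y => ymDensityOfBasis_nonneg b A y
  have hNc : Continuous N := by
    refine continuous_finsetSum _ fun i _ => continuous_finsetSum _ fun j _ =>
      continuous_finsetSum _ fun k _ => ?_
    exact ((contDiff_covDeriv_curvature_apply hA02 (b j) (b k) (b i)).continuous).norm.pow 2
  have hN0 : ∀ y, 0 ≤ N y := fun y => Finset.sum_nonneg fun i _ => Finset.sum_nonneg fun j _ =>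
    Finset.sum_nonneg fun k _ => by positivity
  have hΔc : Continuous Δe := by
    refine continuous_finsetSum _ fun i _ => ?_
    have h1 : ContDiff ℝ 1 fun z => fderiv ℝ e z (b i) :=
      (he2.fderiv_right (m := 1) (by norm_num)).clm_apply contDiff_const
    exact (h1.continuous_fderiv one_ne_zero).clm_apply continuous_const
  have hφcont : Continuous φ := hφ.continuous
  have hdφc : Continuous fun y => fderiv ℝ φ y := hφ.continuous_fderiv one_ne_zero
  have hφ0 : ∀ y, 0 ≤ φ y := fun y => (hφ01 y).1
  have hφ1 : ∀ y, φ y ≤ 1 := fun y => (hφ01 y).2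
  have hK0 : 0 ≤ K := (norm_nonneg _).trans (hK 0)
  -- compact supports and integrability
  have hφ2c : HasCompactSupport fun y => φ y ^ 2 := hasCompactSupport_sq hφc
  have hdφ2c : HasCompactSupport fun y => ‖fderiv ℝ φ y‖ ^ 2 :=
    hasCompactSupport_norm_sq (hφc.fderiv (𝕜 := ℝ))
  have hInt : ∀ {g : E → ℝ}, Continuous g → Integrable fun y => φ y ^ 2 * g y := fun hg =>
    ((hφcont.pow 2).mul hg).integrable_of_hasCompactSupport hφ2c.mul_right
  have hInt' : ∀ {g : E → ℝ}, Continuous g → Integrable fun y => g y * ‖fderiv ℝ φ y‖ ^ 2 :=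
    fun hg => (hg.mul (hdφc.norm.pow 2)).integrable_of_hasCompactSupport hdφ2c.mul_left
  -- volumes and set integrals
  have hVfin : volume V < ⊤ := (measure_mono hVK).trans_lt hKc.measure_lt_top
  have hUfin : volume U < ⊤ := (measure_mono hUK).trans_lt hKc.measure_lt_top
  have hIeU : IntegrableOn e U := (hec.continuousOn.integrableOn_compact hKc).mono_set hUK
  set EV : ℝ := ∫ y in V, e y with hEV
  set κ : ℝ := 1 / (2 * Cs) - A₃ * Real.sqrt EV with hκdef
  -- Step 1: apply the subsolution inequality
  have hS1 : ∫ y, φ y ^ 2 * dte y ≤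
      (∫ y, φ y ^ 2 * Δe y) - (∫ y, φ y ^ 2 * N y) +
        A₃ * ∫ y, φ y ^ 2 * (e y * Real.sqrt (e y)) := by
    have he32 : Continuous fun y => e y * Real.sqrt (e y) := hec.mul (Real.continuous_sqrt.comp hec)
    have hIa : Integrable fun y => φ y ^ 2 * Δe y - φ y ^ 2 * N y := (hInt hΔc).sub (hInt hNc)
    have hIb : Integrable fun y => A₃ * (φ y ^ 2 * (e y * Real.sqrt (e y))) :=
      (hInt he32).const_mul A₃
    have hIab : Integrable fun y => (φ y ^ 2 * Δe y - φ y ^ 2 * N y) +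
        A₃ * (φ y ^ 2 * (e y * Real.sqrt (e y))) := hIa.add hIb
    have h := integral_mono (hInt hdte) hIab fun y => by
      show φ y ^ 2 * dte y ≤ (φ y ^ 2 * Δe y - φ y ^ 2 * N y) +
        A₃ * (φ y ^ 2 * (e y * Real.sqrt (e y)))
      have := mul_le_mul_of_nonneg_left (hineq y) (sq_nonneg (φ y))
      nlinarith [this]
    rw [integral_add hIa hIb, integral_sub (hInt hΔc) (hInt hNc), integral_const_mul] at h
    exact h
  -- Step 2: the Laplacian term
  have hS2 : ∫ y, φ y ^ 2 * Δe y ≤ 1 / 2 * (∫ y, φ y ^ 2 * N y) +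
      4 * ∫ y, e y * ‖fderiv ℝ φ y‖ ^ 2 := by
    have h := integral_sq_mul_laplacian_ymDensity_le b hA hval hφ hφc
    have hsplit : ∫ y, (1 / 2 * φ y ^ 2 * N y + 4 * e y * ‖fderiv ℝ φ y‖ ^ 2) =
        1 / 2 * (∫ y, φ y ^ 2 * N y) + 4 * ∫ y, e y * ‖fderiv ℝ φ y‖ ^ 2 := by
      rw [← integral_const_mul, ← integral_const_mul, ← integral_add ((hInt hNc).const_mul _)
        ((hInt' hec).const_mul _)]
      refine integral_congr_ae (ae_of_all _ fun y => ?_)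
      ring
    rw [hsplit] at h
    exact h
  -- Step 3: the gradient terms are supported in `U`
  have hG : ∫ y, e y * ‖fderiv ℝ φ y‖ ^ 2 ≤ K ^ 2 * ∫ y in U, e y := by
    have hzero : ∀ y ∉ U, e y * ‖fderiv ℝ φ y‖ ^ 2 = 0 := fun y hy => by
      rw [hφU y hy, norm_zero]; ring
    rw [← setIntegral_eq_integral_of_forall_compl_eq_zero hzero, ← integral_const_mul]
    refine setIntegral_mono_on (hInt' hec).integrableOn (hIeU.const_mul _) hU fun y _ => ?_
    calc e y * ‖fderiv ℝ φ y‖ ^ 2 ≤ e y * K ^ 2 :=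
          mul_le_mul_of_nonneg_left (pow_le_pow_left₀ (norm_nonneg _) (hK y) 2) (he0 y)
      _ = K ^ 2 * e y := mul_comm _ _
  have hG' : ∫ y, ‖fderiv ℝ φ y‖ ^ 2 ≤ K ^ 2 * (volume U).toReal := by
    have hzero : ∀ y ∉ U, ‖fderiv ℝ φ y‖ ^ 2 = 0 := fun y hy => by rw [hφU y hy, norm_zero]; ring
    rw [← setIntegral_eq_integral_of_forall_compl_eq_zero hzero]
    calc ∫ y in U, ‖fderiv ℝ φ y‖ ^ 2 ≤ ∫ y in U, K ^ 2 := by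
          refine setIntegral_mono_on ?_ (integrableOn_const hUfin.ne) hU fun y _ =>
            pow_le_pow_left₀ (norm_nonneg _) (hK y) 2
          exact ((hdφc.norm.pow 2).integrable_of_hasCompactSupport hdφ2c).integrableOn
      _ = K ^ 2 * (volume U).toReal := by rw [setIntegral_const, smul_eq_mul, measureReal_def, mul_comm]
  -- Step 4: for each `δ > 0`, the Sobolev test function `w = φ √(e + δ²)`
  have hstep : ∀ δ : ℝ, 0 < δ → ∫ y, φ y ^ 2 * dte y ≤
      -(κ / Real.sqrt ((volume V).toReal)) * (∫ y, φ y ^ 2 * e y) + 5 * K ^ 2 * (∫ y in U, e y) +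
        δ ^ 2 * (K ^ 2 * (volume U).toReal) := by
    intro δ hδ
    set w : E → ℝ := fun y => φ y * Real.sqrt (e y + δ ^ 2) with hw
    have hge : ContDiff ℝ 1 fun y => Real.sqrt (e y + δ ^ 2) :=
      ((he2.of_le (by norm_num)).add contDiff_const).sqrt fun y => by positivity [he0 y]
    have hwC1 : ContDiff ℝ 1 w := hφ.mul hge
    have hwc : HasCompactSupport w := hφc.mul_right
    have hwcont : Continuous w := hwC1.continuous
    have hwV : ∀ y ∉ V, w y = 0 := fun y hy => by simp only [hw, hφV y hy, zero_mul]
    have hw2 : ∀ y, w y ^ 2 = φ y ^ 2 * (e y + δ ^ 2) := fun y => by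
      rw [hw, mul_pow, Real.sq_sqrt (by positivity [he0 y])]
    set X : ℝ := Real.sqrt (∫ y, w y ^ 4) with hX
    have hX0 : 0 ≤ X := Real.sqrt_nonneg _
    -- Sobolev: `X ≤ Cs ∫ ‖Dw‖² ≤ Cs (2 ∫ (e + δ²) ‖Dφ‖² + ∫ φ² N)`
    have hgrad : ∫ y, ‖fderiv ℝ w y‖ ^ 2 ≤
        2 * (∫ y, e y * ‖fderiv ℝ φ y‖ ^ 2) + 2 * δ ^ 2 * (∫ y, ‖fderiv ℝ φ y‖ ^ 2) +
          ∫ y, φ y ^ 2 * N y := by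
      have hpt : ∀ y, ‖fderiv ℝ w y‖ ^ 2 ≤
          2 * (e y * ‖fderiv ℝ φ y‖ ^ 2) + 2 * δ ^ 2 * ‖fderiv ℝ φ y‖ ^ 2 + φ y ^ 2 * N y := by
        intro y
        have h := norm_fderiv_mul_sqrt_sq_le b hA2 hval hφ hδ y
        calc ‖fderiv ℝ w y‖ ^ 2 ≤ 2 * (e y + δ ^ 2) * ‖fderiv ℝ φ y‖ ^ 2 + φ y ^ 2 * N y := h
          _ = 2 * (e y * ‖fderiv ℝ φ y‖ ^ 2) + 2 * δ ^ 2 * ‖fderiv ℝ φ y‖ ^ 2 + φ y ^ 2 * N y := by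
              ring
      have hIdw : Integrable fun y => ‖fderiv ℝ w y‖ ^ 2 :=
        ((hwC1.continuous_fderiv one_ne_zero).norm.pow 2).integrable_of_hasCompactSupport
          (hasCompactSupport_norm_sq (hwc.fderiv (𝕜 := ℝ)))
      have hI1 : Integrable fun y => 2 * (e y * ‖fderiv ℝ φ y‖ ^ 2) := (hInt' hec).const_mul 2
      have hI2 : Integrable fun y => 2 * δ ^ 2 * ‖fderiv ℝ φ y‖ ^ 2 :=
        ((hdφc.norm.pow 2).integrable_of_hasCompactSupport hdφ2c).const_mul _
      have hI3 : Integrable fun y => φ y ^ 2 * N y := hInt hNc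
      have hI12 : Integrable fun y => 2 * (e y * ‖fderiv ℝ φ y‖ ^ 2) +
          2 * δ ^ 2 * ‖fderiv ℝ φ y‖ ^ 2 := hI1.add hI2
      have hI123 : Integrable fun y => (2 * (e y * ‖fderiv ℝ φ y‖ ^ 2) +
          2 * δ ^ 2 * ‖fderiv ℝ φ y‖ ^ 2) + φ y ^ 2 * N y := hI12.add hI3
      have h := integral_mono hIdw hI123 hpt
      rw [integral_add hI12 hI3, integral_add hI1 hI2, integral_const_mul,
        integral_const_mul] at h
      exact h
    have hSob' : X ≤ Cs * ∫ y, ‖fderiv ℝ w y‖ ^ 2 := hSob w hwC1 hwc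
    -- Hölder for the cubic term: `∫ φ² e √e ≤ ∫ w² √e ≤ X √EV`
    have hcubic : ∫ y, φ y ^ 2 * (e y * Real.sqrt (e y)) ≤ X * Real.sqrt EV := by
      have h1 : ∫ y, φ y ^ 2 * (e y * Real.sqrt (e y)) ≤ ∫ y, w y ^ 2 * Real.sqrt (e y) := by
        refine integral_mono (hInt (hec.mul (Real.continuous_sqrt.comp hec)))
          (((hwcont.pow 2).mul (Real.continuous_sqrt.comp hec)).integrable_of_hasCompactSupport
            (hasCompactSupport_sq hwc).mul_right)
          fun y => ?_
        show φ y ^ 2 * (e y * Real.sqrt (e y)) ≤ w y ^ 2 * Real.sqrt (e y)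
        rw [hw2 y]
        have : 0 ≤ φ y ^ 2 * δ ^ 2 * Real.sqrt (e y) := by positivity
        nlinarith [this]
      have h2 := integral_mul_sqrt_le_sqrt_mul_sqrt (f := fun y => w y ^ 2) (g := e)
        (hwcont.pow 2) hec he0 hKc hVK hV (fun y hy => by simp only [hwV y hy]; norm_num)
      have h3 : Real.sqrt (∫ y, (w y ^ 2) ^ 2) = X := by
        rw [hX]
        congr 1
        refine integral_congr_ae (ae_of_all _ fun y => ?_)
        ring
      rw [h3] at h2
      exact h1.trans h2
    -- the localized energy is bounded by `√|V| X`
    have hy : ∫ y, φ y ^ 2 * e y ≤ Real.sqrt ((volume V).toReal) * X := by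
      have h1 : ∫ y, φ y ^ 2 * e y ≤ ∫ y, w y ^ 2 := by
        refine integral_mono (hInt hec) ((hwcont.pow 2).integrable_of_hasCompactSupport
          (hasCompactSupport_sq hwc)) fun y => ?_
        show φ y ^ 2 * e y ≤ w y ^ 2
        rw [hw2 y]
        nlinarith [sq_nonneg (φ y), sq_nonneg δ]
      have h2 : ∫ y, w y ^ 2 = ∫ y in V, w y ^ 2 :=
        (setIntegral_eq_integral_of_forall_compl_eq_zero fun y hy => by
          rw [hwV y hy]; norm_num).symm
      have h3 := setIntegral_sq_le_sqrt_measure_mul_sqrt hwcont hwc hVfin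
      rw [← hX] at h3
      linarith
    -- combine
    have hIN : X / Cs - 2 * (∫ y, e y * ‖fderiv ℝ φ y‖ ^ 2) -
        2 * δ ^ 2 * (∫ y, ‖fderiv ℝ φ y‖ ^ 2) ≤ ∫ y, φ y ^ 2 * N y := by
      have h := hSob'.trans (mul_le_mul_of_nonneg_left hgrad hCs.le)
      have h' := (div_le_iff₀' hCs).mpr h
      linarith
    have hκX : -(κ * X) ≤ -(κ / Real.sqrt ((volume V).toReal)) * ∫ y, φ y ^ 2 * e y := by
      rw [neg_mul, neg_le_neg_iff]
      rcases eq_or_lt_of_le (Real.sqrt_nonneg ((volume V).toReal)) with h0 | hpos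
      · rw [← h0, div_zero, zero_mul]
        exact mul_nonneg hκ hX0
      · rw [div_mul_eq_mul_div, div_le_iff₀ hpos]
        calc κ * (∫ y, φ y ^ 2 * e y) ≤ κ * (Real.sqrt ((volume V).toReal) * X) :=
              mul_le_mul_of_nonneg_left hy hκ
          _ = κ * X * Real.sqrt ((volume V).toReal) := by ring
    have hA₃X : A₃ * ∫ y, φ y ^ 2 * (e y * Real.sqrt (e y)) ≤ A₃ * Real.sqrt EV * X := by
      calc A₃ * ∫ y, φ y ^ 2 * (e y * Real.sqrt (e y)) ≤ A₃ * (X * Real.sqrt EV) :=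
            mul_le_mul_of_nonneg_left hcubic hA₃
        _ = A₃ * Real.sqrt EV * X := by ring
    have hGδ : δ ^ 2 * (∫ y, ‖fderiv ℝ φ y‖ ^ 2) ≤ δ ^ 2 * (K ^ 2 * (volume U).toReal) :=
      mul_le_mul_of_nonneg_left hG' (sq_nonneg δ)
    have hκX' : -(1 / 2) * (X / Cs) + A₃ * Real.sqrt EV * X = -(κ * X) := by
      rw [hκdef]; ring
    linarith [hS1, hS2, hIN, hκX, hA₃X, hG, hGδ, hκX']
  -- Step 5: let `δ → 0`
  refine le_of_forall_pos_le_add fun ε hε => ?_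
  set D : ℝ := K ^ 2 * (volume U).toReal with hD
  have hD0 : 0 ≤ D := by positivity
  obtain ⟨δ, hδ, hδD⟩ : ∃ δ : ℝ, 0 < δ ∧ δ ^ 2 * D ≤ ε := by
    refine ⟨min 1 (ε / (D + 1)), by positivity, ?_⟩
    have h1 : min 1 (ε / (D + 1)) ≤ 1 := min_le_left _ _
    have h2 : min 1 (ε / (D + 1)) ≤ ε / (D + 1) := min_le_right _ _
    have h3 : 0 ≤ min 1 (ε / (D + 1)) := by positivity
    have hsq : (min 1 (ε / (D + 1))) ^ 2 ≤ ε / (D + 1) := by nlinarith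
    calc (min 1 (ε / (D + 1))) ^ 2 * D ≤ ε / (D + 1) * D := mul_le_mul_of_nonneg_right hsq hD0
      _ ≤ ε := by
          rw [div_mul_eq_mul_div, div_le_iff₀ (by positivity)]
          nlinarith
  have h := hstep δ hδ
  linarith

end FixedTime

/-! ### Along the flow -/

section Flow

open scoped Matrix.Norms.Frobenius

attribute [local instance] frobeniusInnerProductSpace

variable {m : Type*} [Fintype m] [DecidableEq m]
variable {E : Type*} [NormedAddCommGroup E] [InnerProductSpace ℝ E] [FiniteDimensional ℝ E]
  [MeasurableSpace E] [BorelSpace E]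
variable {ι : Type*} [Fintype ι] [LinearOrder ι]

/-- **The differential inequality for the localized energy along the flow.** For a jointly smooth
`𝔲(m)`-valued solution of the Yang–Mills heat equation on the open time set `𝒯`, a cut-off `φ`
as in `integral_sq_mul_le_of_subsolution` and `t ∈ 𝒯` with
`κ_t = 1/(2C_S) − 8√2(card ι)³ √(∫_V e(t)) ≥ 0`: the localized energy `y(s) = ∫ φ² e(s)` is
differentiable at `t` with `y'(t) ≤ −(κ_t/√|V|) y(t) + 5K² ∫_U e(t)` (the Bochner inequality
`deriv_ymDensityOfBasis_sub_laplacian_le` fed into `integral_sq_mul_le_of_subsolution`,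
differentiation under the integral). [cite: Waldron2019, proof of Prop. 3.4] -/
theorem hasDerivAt_localizedEnergy_le_of_flow_on (b : OrthonormalBasis ι ℝ E)
    {A : ℝ → Connection E (Matrix m m ℂ)} {𝒯 : Set ℝ} (h𝒯 : IsOpen 𝒯)
    (hA : ContDiffOn ℝ ∞ (fun p : ℝ × E => A p.1 p.2) (𝒯 ×ˢ (univ : Set E)))
    (hval : ∀ ⦃s : ℝ⦄, s ∈ 𝒯 → (A s).IsValuedIn (skewAdjoint.submodule ℝ (Matrix m m ℂ)))
    (hpde : ∀ ⦃s : ℝ⦄, s ∈ 𝒯 → ∀ y w, deriv (fun s' => A s' y w) s = divCurvature (A s) y w)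
    {φ : E → ℝ} (hφ : ContDiff ℝ 1 φ) (hφc : HasCompactSupport φ) (hφ01 : ∀ y, 0 ≤ φ y ∧ φ y ≤ 1)
    {Kc V U : Set E} (hKc : IsCompact Kc) (hVK : V ⊆ Kc) (hV : MeasurableSet V) (hUK : U ⊆ Kc)
    (hU : MeasurableSet U) (hφV : ∀ y ∉ V, φ y = 0) (hφU : ∀ y ∉ U, fderiv ℝ φ y = 0)
    {K : ℝ} (hK : ∀ y, ‖fderiv ℝ φ y‖ ≤ K)
    {Cs : ℝ} (hCs : 0 < Cs) (hSob : ∀ w : E → ℝ, ContDiff ℝ 1 w → HasCompactSupport w →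
      Real.sqrt (∫ y, w y ^ 4) ≤ Cs * ∫ y, ‖fderiv ℝ w y‖ ^ 2)
    {t : ℝ} (ht : t ∈ 𝒯)
    (hκ : 0 ≤ 1 / (2 * Cs) - 8 * Real.sqrt 2 * (Fintype.card ι : ℝ) ^ 3 *
      Real.sqrt (∫ y in V, ymDensityOfBasis b (A t) y)) :
    ∃ yd : ℝ, HasDerivAt (fun s => ∫ y, φ y ^ 2 * ymDensityOfBasis b (A s) y) yd t ∧
      yd ≤ -((1 / (2 * Cs) - 8 * Real.sqrt 2 * (Fintype.card ι : ℝ) ^ 3 *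
          Real.sqrt (∫ y in V, ymDensityOfBasis b (A t) y)) / Real.sqrt ((volume V).toReal)) *
          (∫ y, φ y ^ 2 * ymDensityOfBasis b (A t) y) +
        5 * K ^ 2 * ∫ y in U, ymDensityOfBasis b (A t) y := by
  have h2 : (2 : WithTop ℕ∞) ≤ (⊤ : ℕ∞) := natCast_le_infty₄ 2
  -- the density, its time derivative, and their continuity on the slab
  set e : ℝ × E → ℝ := fun p => ymDensityOfBasis b (A p.1) p.2 with he
  set rate : ℝ × E → ℝ := fun p => 2 * ∑ i, ∑ j,
    fderiv ℝ (fun y => ⟪curvature (A p.1) y (b i) (b j),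
      fderiv ℝ (fun q : ℝ × E => A q.1 q.2) (p.1, y) ((1 : ℝ), (0 : E)) (b j)⟫) p.2 (b i) -
    2 * ∑ j, ‖divCurvature (A p.1) p.2 (b j)‖ ^ 2 with hrate
  have he_c : ContinuousOn e (𝒯 ×ˢ (univ : Set E)) :=
    (contDiffOn_ymDensityOfBasis_joint_on b h𝒯 hA h2).continuousOn
  have hrate_c : ContinuousOn rate (𝒯 ×ˢ (univ : Set E)) :=
    continuousOn_energyRate_of_flow_on b h𝒯 hA h2 hval hpde
  have hderiv : ∀ s ∈ 𝒯, ∀ y, HasDerivAt (fun s' => e (s', y)) (rate (s, y)) s := fun s hs y =>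
    hasDerivAt_ymDensityOfBasis_of_flow_on b h𝒯 hA h2 hs y (hval hs y) (hpde hs y)
  -- differentiation under the integral sign
  have hφ2 : Continuous fun y => φ y ^ 2 := hφ.continuous.pow 2
  have hφ2c : HasCompactSupport fun y => φ y ^ 2 := hasCompactSupport_sq hφc
  have hy := hasDerivAt_integral_mul_of_hasDerivAt_slab h𝒯 he_c hrate_c hderiv hφ2 hφ2c ht
  refine ⟨∫ y, φ y ^ 2 * rate (t, y), hy, ?_⟩
  -- the Bochner inequality at time `t`
  have hsm : ContDiff ℝ ∞ (A t) := contDiff_slice_of_contDiffOn_prod hA ht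
  have hineq : ∀ y, rate (t, y) ≤
      (∑ i, fderiv ℝ (fun z => fderiv ℝ (fun x => ymDensityOfBasis b (A t) x) z (b i)) y (b i)) -
        (∑ i, ∑ j, ∑ k, ‖covDeriv (A t) (fun z => curvature (A t) z (b j) (b k)) y (b i)‖ ^ 2) +
        8 * Real.sqrt 2 * (Fintype.card ι : ℝ) ^ 3 * ymDensityOfBasis b (A t) y *
          Real.sqrt (ymDensityOfBasis b (A t) y) := by
    intro y
    have h := deriv_ymDensityOfBasis_sub_laplacian_le b h𝒯 hA hpde ht (hval ht) y
    rw [(hderiv t ht y).deriv] at h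
    have h' : rate (t, y) -
        ∑ i, fderiv ℝ (fun z => fderiv ℝ (fun x => ymDensityOfBasis b (A t) x) z (b i)) y (b i) ≤
        -(∑ i, ∑ j, ∑ k, ‖covDeriv (A t) (fun z => curvature (A t) z (b j) (b k)) y (b i)‖ ^ 2) +
          8 * Real.sqrt 2 * (Fintype.card ι : ℝ) ^ 3 *
            (ymDensityOfBasis b (A t) y * Real.sqrt (ymDensityOfBasis b (A t) y)) := h
    linarith
  have hrate_t : Continuous fun y => rate (t, y) := continuous_slice_of_continuousOn_slab hrate_c ht
  exact integral_sq_mul_le_of_subsolution b hsm (hval ht) hφ hφc hφ01 hKc hVK hV hUK hU hφV hφU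
    hK hCs hSob (by positivity) hrate_t hineq hκ

omit [DecidableEq m] [Fintype m] [LinearOrder ι] [Fintype ι] in
/-- **Grönwall for `y' ≤ −a y + β`** (`a > 0`): `y(t) ≤ y(t₀)e^{−a(t−t₀)} + (β/a)(1 − e^{−a(t−t₀)})`
on `[t₀, t₁]`. [folklore] -/
theorem le_exp_decay_of_deriv_le {y : ℝ → ℝ} {t₀ t₁ a β : ℝ} (ha : 0 < a)
    (hcont : ContinuousOn y (Icc t₀ t₁)) (hy : ∀ t ∈ Ico t₀ t₁, HasDerivAt y (deriv y t) t)
    (hbound : ∀ t ∈ Ico t₀ t₁, deriv y t ≤ -a * y t + β) :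
    ∀ t ∈ Icc t₀ t₁, y t ≤ y t₀ * Real.exp (-a * (t - t₀)) + β / a * (1 - Real.exp (-a * (t - t₀))) := by
  intro t ht
  have h := le_gronwallBound_of_liminf_deriv_right_le (f := y) (f' := deriv y) (δ := y t₀) (K := -a)
    (ε := β) hcont (fun x hx r hr => (hy x hx).hasDerivWithinAt.liminf_right_slope_le hr) le_rfl
    (fun x hx => by have := hbound x hx; linarith) t ht
  rw [gronwallBound_of_K_ne_0 (by linarith : (-a) ≠ 0)] at h
  calc y t ≤ y t₀ * Real.exp (-a * (t - t₀)) + β / -a * (Real.exp (-a * (t - t₀)) - 1) := h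
    _ = y t₀ * Real.exp (-a * (t - t₀)) + β / a * (1 - Real.exp (-a * (t - t₀))) := by
        rw [div_neg]; ring

/-- The volume of a ball in a four-dimensional inner product space: `|B_R(x₀)| = R⁴ |B₁(0)|`.
[folklore] -/
theorem volume_ball_toReal_of_finrank_eq_four (hE : Module.finrank ℝ E = 4) (x₀ : E) {R : ℝ}
    (hR : 0 < R) : (volume (ball x₀ R)).toReal = R ^ 4 * (volume (ball (0 : E) 1)).toReal := by
  rw [Measure.addHaar_ball_of_pos volume x₀ hR, hE, ENNReal.toReal_mul,
    ENNReal.toReal_ofReal (by positivity)]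

/-- **Waldron's Proposition 3.4** (flat case `B = 0`, `R₀ = ∞`; `|F|² = ∑_{i<j}‖F_{ij}‖²`, balls
`B_ρ = B_ρ(x₀)`, annulus `U_{R/2}^R = B̄_R ∖ B_{R/2}`), for a four-dimensional `E`. There are
absolute constants `ε₀ > 0`, `c > 0`, `C ≥ 0` (depending only on `E`: a Sobolev constant, the
volume of the unit ball, the cut-off gradient constant) such that for every jointly smooth
`𝔲(m)`-valued solution of the Yang–Mills heat equation on an open time set `𝒯 ⊇ [t₀, T)`:
if `‖F(t₀)‖²_{L²(B_R)} ≤ ε₁ < ε₀` and `sup_{t₀ ≤ t < T} ‖F(t)‖²_{L²(U_{R/2}^R)} ≤ ε₂ < ε₀`, then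
`‖F(t)‖²_{L²(B_{R/2})} ≤ ε₁ e^{−c(t−t₀)/R²} + C ε₂ (1 − e^{−c(t−t₀)/R²})` for `t₀ ≤ t < T`.
Proof as printed: the differential inequality for `e = |F|²` tested against `φ²`
(`hasDerivAt_localizedEnergy_le_of_flow_on`), Grönwall, and the maximal time `T₀` up to which
`‖F(t)‖²_{L²(B_R)} < η` (here: the first time it reaches `η`, by continuity), which equals `T`
once `2(1 + C)ε₀ < η`. [cite: Waldron2019, Prop. 3.4] -/
theorem Waldron2019_prop_3_4 (hE : Module.finrank ℝ E = 4) (b : OrthonormalBasis ι ℝ E) :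
    ∃ ε₀ : ℝ, 0 < ε₀ ∧ ∃ c : ℝ, 0 < c ∧ ∃ C : ℝ, 0 ≤ C ∧
      ∀ {A : ℝ → Connection E (Matrix m m ℂ)} {𝒯 : Set ℝ}, IsOpen 𝒯 →
        ContDiffOn ℝ ∞ (fun p : ℝ × E => A p.1 p.2) (𝒯 ×ˢ (univ : Set E)) →
        (∀ ⦃s : ℝ⦄, s ∈ 𝒯 → (A s).IsValuedIn (skewAdjoint.submodule ℝ (Matrix m m ℂ))) →
        (∀ ⦃s : ℝ⦄, s ∈ 𝒯 → ∀ y w, deriv (fun s' => A s' y w) s = divCurvature (A s) y w) →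
        ∀ (x₀ : E) {R : ℝ}, 0 < R → ∀ {t₀ T : ℝ}, Ico t₀ T ⊆ 𝒯 →
        ∀ {ε₁ ε₂ : ℝ}, 0 ≤ ε₁ → ε₁ < ε₀ → 0 ≤ ε₂ → ε₂ < ε₀ →
        (∫ y in ball x₀ R, ymDensityOfBasis b (A t₀) y ≤ ε₁) →
        (∀ t ∈ Ico t₀ T, ∫ y in closedBall x₀ R \ ball x₀ (R / 2), ymDensityOfBasis b (A t) y ≤ ε₂) →
        ∀ t ∈ Ico t₀ T, ∫ y in ball x₀ (R / 2), ymDensityOfBasis b (A t) y ≤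
          ε₁ * Real.exp (-c * (t - t₀) / R ^ 2) + C * ε₂ * (1 - Real.exp (-c * (t - t₀) / R ^ 2)) := by
  -- universal constants
  obtain ⟨Cs, hCs, hSob⟩ := sobolev_sqrt_le_of_finrank_eq_four (E := E) hE
  obtain ⟨M, hM0, hrad⟩ := Literature.Analysis.Calculus.exists_radial_cutoff_gradient_le (E := E)
  set A₃ : ℝ := 8 * Real.sqrt 2 * (Fintype.card ι : ℝ) ^ 3 with hA₃
  have hA₃0 : 0 ≤ A₃ := by positivity
  set v₁ : ℝ := (volume (ball (0 : E) 1)).toReal with hv₁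
  have hv₁0 : 0 < v₁ := by
    rw [hv₁]
    refine ENNReal.toReal_pos (measure_ball_pos volume (0 : E) one_pos).ne' ?_
    exact ((measure_mono ball_subset_closedBall).trans_lt
      (isCompact_closedBall (0 : E) 1).measure_lt_top).ne
  -- the smallness threshold `η` with `A₃ √η ≤ 1/(4 C_S)`
  set η : ℝ := (1 / (4 * Cs * (A₃ + 1))) ^ 2 with hη
  have hη0 : 0 < η := by positivity
  have hsqrtη : Real.sqrt η = 1 / (4 * Cs * (A₃ + 1)) := by
    rw [hη, Real.sqrt_sq (by positivity)]
  have hκη : 1 / (4 * Cs) ≤ 1 / (2 * Cs) - A₃ * Real.sqrt η := by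
    rw [hsqrtη]
    have h1 : A₃ * (1 / (4 * Cs * (A₃ + 1))) ≤ 1 / (4 * Cs) := by
      rw [mul_one_div, div_le_div_iff₀ (by positivity) (by positivity)]
      nlinarith [hCs]
    have h2 : 1 / (2 * Cs) = 2 * (1 / (4 * Cs)) := by field_simp; ring
    linarith
  set α : ℝ := 1 / (4 * Cs) / Real.sqrt v₁ with hα
  have hα0 : 0 < α := by positivity
  set C : ℝ := 20 * M ^ 2 / α with hC
  have hC0 : 0 ≤ C := by positivity
  set ε₀ : ℝ := η / (2 * (C + 2)) with hε₀
  have hε₀0 : 0 < ε₀ := by positivity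
  refine ⟨ε₀, hε₀0, α, hα0, C, hC0, ?_⟩
  intro A 𝒯 h𝒯 hA hval hpde x₀ R hR t₀ T hsub ε₁ ε₂ hε₁0 hε₁ hε₂0 hε₂ hinit hann t ht
  have h2 : (2 : WithTop ℕ∞) ≤ (⊤ : ℕ∞) := natCast_le_infty₄ 2
  -- the cut-off for `B_{R/2} ⊂ B_R`
  obtain ⟨φ, hφs, hφ0, hφ1, hone, hzero, hφcs, hgrad⟩ := hrad x₀ (R / 2) R (by positivity)
    (by linarith)
  have hφC1 : ContDiff ℝ 1 φ := hφs.of_le (natCast_le_infty₄ 1)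
  have hφ01 : ∀ y, 0 ≤ φ y ∧ φ y ≤ 1 := fun y => ⟨hφ0 y, hφ1 y⟩
  set K : ℝ := 2 * M / R with hKdef
  have hK : ∀ y, ‖fderiv ℝ φ y‖ ≤ K := fun y => by
    have h := hgrad y
    rwa [show R - R / 2 = R / 2 by ring, div_div_eq_mul_div, mul_comm M 2] at h
  set V : Set E := ball x₀ R with hVdef
  set U : Set E := closedBall x₀ R \ ball x₀ (R / 2) with hUdef
  have hKc : IsCompact (closedBall x₀ R) := isCompact_closedBall _ _
  have hVK : V ⊆ closedBall x₀ R := ball_subset_closedBall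
  have hUK : U ⊆ closedBall x₀ R := fun _ hy => hy.1
  have hVm : MeasurableSet V := measurableSet_ball
  have hUm : MeasurableSet U := measurableSet_closedBall.diff measurableSet_ball
  have hφV : ∀ y ∉ V, φ y = 0 := fun y hy => hzero y (not_lt.mp (mt mem_ball.mpr hy))
  have hφU : ∀ y ∉ U, fderiv ℝ φ y = 0 := by
    intro y hy
    by_cases h1 : dist y x₀ ≤ R
    · -- then `dist y x₀ < R/2`: `φ ≡ 1` near `y`
      have h2 : dist y x₀ < R / 2 := by
        by_contra h2
        exact hy ⟨mem_closedBall.mpr h1, fun hb => h2 (mem_ball.mp hb)⟩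
      have hev : φ =ᶠ[𝓝 y] fun _ => (1 : ℝ) := by
        filter_upwards [Metric.isOpen_ball.mem_nhds (mem_ball.mpr h2)] with z hz
        exact hone z (mem_ball.mp hz).le
      rw [hev.fderiv_eq, fderiv_const_apply]
    · exact fderiv_eq_zero_of_nonneg_of_eq_zero hφ0 (hzero y (le_of_lt (not_le.mp h1)))
  -- volume of `V`
  have hvolV : (volume V).toReal = R ^ 4 * v₁ := volume_ball_toReal_of_finrank_eq_four hE x₀ hR
  have hsqrtV : Real.sqrt ((volume V).toReal) = R ^ 2 * Real.sqrt v₁ := by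
    rw [hvolV, Real.sqrt_mul (by positivity), show R ^ 4 = (R ^ 2) ^ 2 by ring,
      Real.sqrt_sq (by positivity)]
  -- the energies
  set g : ℝ → ℝ := fun s => ∫ y in V, ymDensityOfBasis b (A s) y with hgdef
  set yl : ℝ → ℝ := fun s => ∫ y, φ y ^ 2 * ymDensityOfBasis b (A s) y with hyl
  set EU : ℝ → ℝ := fun s => ∫ y in U, ymDensityOfBasis b (A s) y with hEU
  have he_c : ContinuousOn (fun p : ℝ × E => ymDensityOfBasis b (A p.1) p.2) (𝒯 ×ˢ univ) :=
    (contDiffOn_ymDensityOfBasis_joint_on b h𝒯 hA h2).continuousOn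
  have hslice : ∀ {s : ℝ}, s ∈ 𝒯 → Continuous fun y => ymDensityOfBasis b (A s) y := fun hs =>
    continuous_slice_of_continuousOn_slab he_c hs
  have he0 : ∀ s y, 0 ≤ ymDensityOfBasis b (A s) y := fun s y => ymDensityOfBasis_nonneg b _ y
  have hInt : ∀ {s : ℝ}, s ∈ 𝒯 → ∀ {W : Set E}, W ⊆ closedBall x₀ R →
      IntegrableOn (fun y => ymDensityOfBasis b (A s) y) W := fun hs W hW =>
    ((hslice hs).continuousOn.integrableOn_compact hKc).mono_set hW
  -- (c1) `∫_{B_{R/2}} e ≤ yl`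
  have hc1 : ∀ {s : ℝ}, s ∈ 𝒯 → ∫ y in ball x₀ (R / 2), ymDensityOfBasis b (A s) y ≤ yl s := by
    intro s hs
    have hfi : Integrable fun y => φ y ^ 2 * ymDensityOfBasis b (A s) y :=
      ((hφs.continuous.pow 2).mul (hslice hs)).integrable_of_hasCompactSupport
        (hasCompactSupport_sq hφcs).mul_right
    calc ∫ y in ball x₀ (R / 2), ymDensityOfBasis b (A s) y
        = ∫ y in ball x₀ (R / 2), φ y ^ 2 * ymDensityOfBasis b (A s) y :=
          setIntegral_congr_fun measurableSet_ball fun y hy => by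
            rw [hone y (mem_ball.mp hy).le, one_pow, one_mul]
      _ ≤ yl s := setIntegral_le_integral hfi (ae_of_all _ fun y =>
          mul_nonneg (sq_nonneg _) (he0 s y))
  -- (c2) `yl ≤ g`
  have hc2 : ∀ {s : ℝ}, s ∈ 𝒯 → yl s ≤ g s := by
    intro s hs
    have hzero' : ∀ y ∉ V, φ y ^ 2 * ymDensityOfBasis b (A s) y = 0 := fun y hy => by
      rw [hφV y hy]; ring
    show (∫ y, φ y ^ 2 * ymDensityOfBasis b (A s) y) ≤ ∫ y in V, ymDensityOfBasis b (A s) y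
    rw [← setIntegral_eq_integral_of_forall_compl_eq_zero hzero']
    refine setIntegral_mono_on (((hφs.continuous.pow 2).mul (hslice hs)).continuousOn.integrableOn_compact
      hKc |>.mono_set hVK) (hInt hs hVK) hVm fun y _ => ?_
    calc φ y ^ 2 * ymDensityOfBasis b (A s) y ≤ 1 * ymDensityOfBasis b (A s) y := by
          refine mul_le_mul_of_nonneg_right ?_ (he0 s y)
          nlinarith [hφ0 y, hφ1 y]
      _ = ymDensityOfBasis b (A s) y := one_mul _
  -- (c3) `g ≤ ∫_{B_{R/2}} e + EU`
  have hc3 : ∀ {s : ℝ}, s ∈ 𝒯 → g s ≤ (∫ y in ball x₀ (R / 2), ymDensityOfBasis b (A s) y) + EU s := by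
    intro s hs
    have hsplit : V = ball x₀ (R / 2) ∪ (V \ ball x₀ (R / 2)) :=
      (union_sdiff_cancel (ball_subset_ball (by linarith))).symm
    have hdisj : Disjoint (ball x₀ (R / 2)) (V \ ball x₀ (R / 2)) := disjoint_sdiff_right
    show (∫ y in V, ymDensityOfBasis b (A s) y) ≤
      (∫ y in ball x₀ (R / 2), ymDensityOfBasis b (A s) y) + ∫ y in U, ymDensityOfBasis b (A s) y
    rw [hsplit, setIntegral_union hdisj (hVm.diff measurableSet_ball)
      (hInt hs (ball_subset_closedBall.trans (closedBall_subset_closedBall (by linarith))))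
      (hInt hs (fun _ hy => hVK hy.1))]
    have hmono : ∫ y in V \ ball x₀ (R / 2), ymDensityOfBasis b (A s) y ≤
        ∫ y in U, ymDensityOfBasis b (A s) y :=
      setIntegral_mono_set (hInt hs hUK) (ae_of_all _ fun y => he0 s y)
        (ae_of_all _ fun y hy => ⟨hVK hy.1, hy.2⟩)
    linarith
  -- continuity of `g` and differentiability of `yl`
  have hg_c : ContinuousOn g 𝒯 := continuousOn_setIntegral_of_continuousOn_slab h𝒯 he_c hKc hVK hVm
  have hyl_d : ∀ {s : ℝ}, s ∈ 𝒯 → DifferentiableAt ℝ yl s := by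
    intro s hs
    set rate : ℝ × E → ℝ := fun p => 2 * ∑ i, ∑ j,
      fderiv ℝ (fun y => ⟪curvature (A p.1) y (b i) (b j),
        fderiv ℝ (fun q : ℝ × E => A q.1 q.2) (p.1, y) ((1 : ℝ), (0 : E)) (b j)⟫) p.2 (b i) -
      2 * ∑ j, ‖divCurvature (A p.1) p.2 (b j)‖ ^ 2 with hrate
    have hrate_c : ContinuousOn rate (𝒯 ×ˢ (univ : Set E)) :=
      continuousOn_energyRate_of_flow_on b h𝒯 hA h2 hval hpde
    have hderiv : ∀ s' ∈ 𝒯, ∀ y, HasDerivAt (fun s'' => ymDensityOfBasis b (A s'') y) (rate (s', y)) s' :=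
      fun s' hs' y => hasDerivAt_ymDensityOfBasis_of_flow_on b h𝒯 hA h2 hs' y (hval hs' y) (hpde hs' y)
    exact (hasDerivAt_integral_mul_of_hasDerivAt_slab (e := fun p => ymDensityOfBasis b (A p.1) p.2)
      h𝒯 he_c hrate_c hderiv (hφs.continuous.pow 2) (hasCompactSupport_sq hφcs) hs).differentiableAt
  -- the differential inequality while `g ≤ η`
  have hdiff_ineq : ∀ {s : ℝ}, s ∈ Ico t₀ T → g s ≤ η →
      deriv yl s ≤ -(α / R ^ 2) * yl s + (20 * M ^ 2 / R ^ 2) * ε₂ := by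
    intro s hs hgs
    have hs𝒯 : s ∈ 𝒯 := hsub hs
    have hκs : 1 / (4 * Cs) ≤ 1 / (2 * Cs) - A₃ * Real.sqrt (g s) := by
      have : A₃ * Real.sqrt (g s) ≤ A₃ * Real.sqrt η :=
        mul_le_mul_of_nonneg_left (Real.sqrt_le_sqrt hgs) hA₃0
      linarith
    have hκs0 : 0 ≤ 1 / (2 * Cs) - A₃ * Real.sqrt (g s) := le_trans (by positivity) hκs
    obtain ⟨yd, hyd, hbd⟩ := hasDerivAt_localizedEnergy_le_of_flow_on b h𝒯 hA hval hpde hφC1 hφcs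
      hφ01 hKc hVK hVm hUK hUm hφV hφU hK hCs hSob hs𝒯 hκs0
    rw [hyd.deriv]
    have hyl0 : 0 ≤ yl s := integral_nonneg fun y => mul_nonneg (sq_nonneg _) (he0 s y)
    have hEU : EU s ≤ ε₂ := hann s hs
    have hK2 : 5 * K ^ 2 = 20 * M ^ 2 / R ^ 2 := by rw [hKdef]; field_simp; ring
    have hcoef : α / R ^ 2 ≤ (1 / (2 * Cs) - A₃ * Real.sqrt (g s)) / Real.sqrt ((volume V).toReal) := by
      rw [hsqrtV, hα, div_div, div_le_div_iff₀ (by positivity) (by positivity)]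
      calc 1 / (4 * Cs) * (R ^ 2 * Real.sqrt v₁) = 1 / (4 * Cs) * (Real.sqrt v₁ * R ^ 2) := by ring
        _ ≤ (1 / (2 * Cs) - A₃ * Real.sqrt (g s)) * (Real.sqrt v₁ * R ^ 2) :=
            mul_le_mul_of_nonneg_right hκs (by positivity)
    calc yd ≤ -((1 / (2 * Cs) - A₃ * Real.sqrt (g s)) / Real.sqrt ((volume V).toReal)) * yl s +
          5 * K ^ 2 * EU s := hbd
      _ ≤ -(α / R ^ 2) * yl s + 5 * K ^ 2 * ε₂ := by
          have h1 : 5 * K ^ 2 * EU s ≤ 5 * K ^ 2 * ε₂ := mul_le_mul_of_nonneg_left hEU (by positivity)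
          have h2 := mul_le_mul_of_nonneg_right hcoef hyl0
          linarith
      _ = -(α / R ^ 2) * yl s + (20 * M ^ 2 / R ^ 2) * ε₂ := by rw [hK2]
  -- Grönwall on an interval where `g ≤ η`
  have hgron : ∀ {t₁ : ℝ}, t₁ ∈ Ico t₀ T → (∀ s ∈ Icc t₀ t₁, g s ≤ η) →
      yl t₁ ≤ ε₁ * Real.exp (-α * (t₁ - t₀) / R ^ 2) + C * ε₂ * (1 - Real.exp (-α * (t₁ - t₀) / R ^ 2)) := by
    intro t₁ ht₁ hη
    have h01 : t₀ ≤ t₁ := ht₁.1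
    have hI𝒯 : Icc t₀ t₁ ⊆ 𝒯 := fun s hs => hsub ⟨hs.1, hs.2.trans_lt ht₁.2⟩
    have hcont : ContinuousOn yl (Icc t₀ t₁) := fun s hs =>
      (hyl_d (hI𝒯 hs)).continuousAt.continuousWithinAt
    have hder : ∀ s ∈ Ico t₀ t₁, HasDerivAt yl (deriv yl s) s := fun s hs =>
      (hyl_d (hI𝒯 ⟨hs.1, hs.2.le⟩)).hasDerivAt
    have hbd : ∀ s ∈ Ico t₀ t₁, deriv yl s ≤ -(α / R ^ 2) * yl s + (20 * M ^ 2 / R ^ 2) * ε₂ :=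
      fun s hs => hdiff_ineq ⟨hs.1, hs.2.trans ht₁.2⟩ (hη s ⟨hs.1, hs.2.le⟩)
    have h := le_exp_decay_of_deriv_le (by positivity : 0 < α / R ^ 2) hcont hder hbd t₁ ⟨h01, le_rfl⟩
    have hy0 : yl t₀ ≤ ε₁ := (hc2 (hsub ⟨le_rfl, h01.trans_lt ht₁.2⟩)).trans hinit
    have hexp : Real.exp (-(α / R ^ 2) * (t₁ - t₀)) = Real.exp (-α * (t₁ - t₀) / R ^ 2) := by
      congr 1; ring
    have hexp0 : 0 ≤ Real.exp (-α * (t₁ - t₀) / R ^ 2) := (Real.exp_pos _).le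
    have hexp1 : Real.exp (-α * (t₁ - t₀) / R ^ 2) ≤ 1 := by
      rw [Real.exp_le_one_iff, neg_mul]
      exact div_nonpos_of_nonpos_of_nonneg
        (neg_nonpos.mpr (mul_nonneg hα0.le (sub_nonneg.mpr h01))) (by positivity)
    have hCeq : 20 * M ^ 2 / R ^ 2 * ε₂ / (α / R ^ 2) = C * ε₂ := by
      rw [hC]; field_simp
    rw [hexp, hCeq] at h
    calc yl t₁ ≤ yl t₀ * Real.exp (-α * (t₁ - t₀) / R ^ 2) +
          C * ε₂ * (1 - Real.exp (-α * (t₁ - t₀) / R ^ 2)) := h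
      _ ≤ ε₁ * Real.exp (-α * (t₁ - t₀) / R ^ 2) +
          C * ε₂ * (1 - Real.exp (-α * (t₁ - t₀) / R ^ 2)) := by
          have := mul_le_mul_of_nonneg_right hy0 hexp0
          linarith
  -- consequence: while `g ≤ η` on `[t₀, t₁]`, in fact `g(t₁) < η/2`
  have hhalf : ∀ {t₁ : ℝ}, t₁ ∈ Ico t₀ T → (∀ s ∈ Icc t₀ t₁, g s ≤ η) → g t₁ < η / 2 := by
    intro t₁ ht₁ hη'
    have ht₁𝒯 : t₁ ∈ 𝒯 := hsub ht₁
    have hy := hgron ht₁ hη'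
    have hexp0 : 0 ≤ Real.exp (-α * (t₁ - t₀) / R ^ 2) := (Real.exp_pos _).le
    have hexp1 : Real.exp (-α * (t₁ - t₀) / R ^ 2) ≤ 1 := by
      rw [Real.exp_le_one_iff, neg_mul]
      exact div_nonpos_of_nonpos_of_nonneg
        (neg_nonpos.mpr (mul_nonneg hα0.le (sub_nonneg.mpr ht₁.1))) (by positivity)
    have hyl1 : yl t₁ ≤ ε₁ + C * ε₂ := by
      have h1 : ε₁ * Real.exp (-α * (t₁ - t₀) / R ^ 2) ≤ ε₁ := mul_le_of_le_one_right hε₁0 hexp1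
      have h2 : C * ε₂ * (1 - Real.exp (-α * (t₁ - t₀) / R ^ 2)) ≤ C * ε₂ :=
        mul_le_of_le_one_right (by positivity) (by linarith)
      linarith
    have hg1 : g t₁ ≤ yl t₁ + ε₂ := by
      have h3 := hc3 ht₁𝒯
      have h1 := hc1 ht₁𝒯
      have h4 : EU t₁ ≤ ε₂ := hann t₁ ht₁
      linarith
    have hη2 : (C + 2) * ε₀ = η / 2 := by rw [hε₀]; field_simp
    have hC1 : (C + 1) * ε₂ ≤ (C + 1) * ε₀ := mul_le_mul_of_nonneg_left hε₂.le (by positivity)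
    linarith
  -- bootstrap: `g ≤ η` on `[t₀, t]` (the first time `g` reaches `η` cannot exist)
  have ht𝒯 : t ∈ 𝒯 := hsub ht
  have hIcc𝒯 : Icc t₀ t ⊆ 𝒯 := fun s hs => hsub ⟨hs.1, hs.2.trans_lt ht.2⟩
  have hε₀η : ε₀ < η := by
    rw [hε₀, div_lt_iff₀ (by positivity)]
    nlinarith
  have hall : ∀ s ∈ Icc t₀ t, g s ≤ η := by
    by_contra hcon
    push Not at hcon
    obtain ⟨s₁, hs₁, hgs₁⟩ := hcon
    set B : Set ℝ := Icc t₀ t ∩ g ⁻¹' Ici η with hB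
    have hBc : IsClosed B :=
      (hg_c.mono hIcc𝒯).preimage_isClosed_of_isClosed isClosed_Icc isClosed_Ici
    have hne : B.Nonempty := ⟨s₁, hs₁, hgs₁.le⟩
    have hbdd : BddBelow B := ⟨t₀, fun s hs => hs.1.1⟩
    set τ : ℝ := sInf B with hτ
    have hτB : τ ∈ B := hBc.csInf_mem hne hbdd
    have hτI : τ ∈ Icc t₀ t := hτB.1
    have hτg : η ≤ g τ := hτB.2
    -- before `τ`, `g < η`
    have hbefore : ∀ s ∈ Ico t₀ τ, g s < η := by
      intro s hs
      by_contra hge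
      have hsB : s ∈ B := ⟨⟨hs.1, hs.2.le.trans hτI.2⟩, not_lt.mp hge⟩
      exact (not_le.mpr hs.2) (csInf_le hbdd hsB)
    -- `τ > t₀`
    have hτ0 : t₀ < τ := by
      rcases eq_or_lt_of_le hτI.1 with h | h
      · exfalso
        have hg0 : g t₀ ≤ ε₁ := hinit
        rw [← h] at hτg
        linarith
      · exact h
    -- at `τ`, by continuity, `g τ ≤ η`; hence `g ≤ η` on `[t₀, τ]`
    have hτη : ∀ s ∈ Icc t₀ τ, g s ≤ η := by
      intro s hs
      rcases eq_or_lt_of_le hs.2 with h | h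
      · rw [h]
        have hcont : ContinuousAt g τ := (hg_c τ (hIcc𝒯 hτI)).continuousAt
          (h𝒯.mem_nhds (hIcc𝒯 hτI))
        have htend : Tendsto g (𝓝[<] τ) (𝓝 (g τ)) := hcont.tendsto.mono_left nhdsWithin_le_nhds
        refine le_of_tendsto htend ?_
        filter_upwards [Ioo_mem_nhdsLT hτ0] with s' hs'
        exact (hbefore s' ⟨hs'.1.le, hs'.2⟩).le
      · exact (hbefore s ⟨hs.1, h⟩).le
    have hτT : τ ∈ Ico t₀ T := ⟨hτI.1, hτI.2.trans_lt ht.2⟩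
    have hlt := hhalf hτT hτη
    linarith
  -- conclusion
  calc ∫ y in ball x₀ (R / 2), ymDensityOfBasis b (A t) y ≤ yl t := hc1 ht𝒯
    _ ≤ ε₁ * Real.exp (-α * (t - t₀) / R ^ 2) + C * ε₂ * (1 - Real.exp (-α * (t - t₀) / R ^ 2)) :=
        hgron ht hall

end Flow

end Literature.MathematicalPhysics.QuantumLattice
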